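import Literature.Computability.Cryptography.CryptoFoundationsOneWayFunctions
import Literature.Computability.Cryptography.Pseudorandomness
import Literature.Computability.Complexity.EncodingFrames
import Literature.Computability.Complexity.TimeBoundsProofs
import Mathlib.Analysis.SpecificLimits.Normed
import Mathlib.Analysis.SpecialFunctions.Exp
import HarnessLib

/-!
# Yao's amplification: weak one-way functions yield strong one-way functions (S05)

The mathematics of **crypto-foundations.S05** `weakOWFExist_iff_OWFExist`
(`CryptoFoundationsOneWayFunctions.lean`; Yao 1982, Goldreich 2001 Thm. 2.3.2): the direct
product `g(x₁, …, x_t) = (f(x₁), …, f(x_t))`, `t(n) = n·q(n)`, of a weak one-way function `f`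
(every PPT inverter fails with probability `≥ 1/q(n)`) is strongly one-way. This file proves the
theorem **modulo two efficiency facts** (`yaoFun_polyTime`: `g` is polynomial-time;
`yaoRun_polyTime`: the run function of the inverter `A'` of the reduction is polynomial-time), which are statements about TM2
programs to be discharged with the `FP` toolkit in sibling files:

* `Yao.Params.isOneWay_g` — the core: weak one-wayness of `f` + the two efficiency hypotheses ⇒
  `IsOneWay g`;
* `OWFExist_of_weakOWFExist_of`, `weakOWFExist_iff_OWFExist_of` — S05 from the two facts.

## The printed proof (Goldreich 2001, §2.3.1) and its rendering

Print: suppose a PPT `B'` inverts `g` on `U_m`, `m = n²p(n)`, with probability `> 1/q(m)` for the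
`m` of an infinite set; the inverter `A'` for `f` on `y = f(x)` runs, `a(n) = 2n²p(n)q(n²p(n))`
times, the procedure `I`: for each position `i ≤ t(n)` put `y` at position `i` among fresh
`f`-images of random blocks, run `B'`, and output the `i`-th block of the answer if it is an
`f`-preimage of `y`. With `S_n = {x : Pr[I inverts f(x)] > n/a(n)}`: Claim 2.3.2.1, for `x ∈ S_n`
`A'` fails with probability `< (1 - n/a(n))^{a(n)} < 2⁻ⁿ`; Claim 2.3.2.2, `|S_n| > (1 - 1/2p(n))·2ⁿ`,
as otherwise `s(n) = Pr[B' inverts] = s₁(n) + s₂(n)` with `s₁(n) ≤ Σᵢ max_{x ∉ S_n} Pr[I inverts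
f(x)] ≤ n²p(n)/a(n)` (eq. (2.8): a success of `B'` conditioned on `U⁽ⁱ⁾ = x` is a success of `I`
on `f(x)`) and `s₂(n) ≤ Pr[∀ i, U⁽ⁱ⁾ ∈ S_n] ≤ (1 - 1/2p(n))^{np(n)} < 2^{-n/2}`; hence
`Pr[A' inverts f on U_n] ≥ (1 - 1/2p(n))(1 - 2⁻ⁿ) > 1 - 1/p(n)` infinitely often — contradiction.

Here (names: print's `p` is our `q`; `θ = 1/θinv` plays `n/a(n)`, `reps = a(n)`):

* **All input lengths.** Print defines `g` only on the lengths `n²p(n)` and delegates the other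
  lengths to §2.2.3 (Prop. 2.2.3, which tries *all* candidate lengths, using on-line coin tosses).
  We define `g` on every length (`Yao.Params.g`): on `|w| = m` take the block length
  `n = nOf m` (the largest `n` with `n²q(n) ≤ m`), apply `f` to the `t(n)` leading `n`-blocks, **pad**
  each image to the common length `p(n)+1` (`y ↦ y10…0`, print's eq. (2.3) — this makes `g`
  length-regular, `length_g`, so that all queries of the reduction have one length and `B'` one
  coin count `κ`), and pair-encode the list of images together with the untouched suffix
  (`frames`, injective). A `g`-preimage of a hybrid then yields an `f`-preimage in block `i`
  (`f_blk_eq_of_g_eq`: equal numbers of components force equal block lengths, `t` being strictly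
  increasing).
* **Which length to attack, and `B'`'s coin count.** For a block length `n` the reduction must
  attack one target length `m ∈ [M n, M(n+1))` on which `B'` does well, and must hand `B'` exactly
  `κ = coinLen_{B'}(query length)` coins; neither is computable from `n` (in the tree's model of
  probabilistic machines, `RandAlg`, the coin budget `coinLen` of an adversary is an arbitrary
  polynomially bounded function). As in `LiuPassPadding.lean` (`lpAdvDist`), the pair
  `(idx, κ)`, `m = M n + idx`, is carried by the *number of coins* of `A'`:
  `|r| = idx·K_b(n) + κ + Base(n)·R(n)` (`Yao.Params.run` decodes it by `mod`/`div`; `run_boolPair`),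
  the coin budget being a function of the input length `ℓ = |⟨1ⁿ, f x⟩| = 2n + 2 + |f x|`. Since
  `ℓ` does not determine `n`, the proof attacks only a sparse infinite set of good block lengths
  with disjoint ranges `[2n+2, 2n+2+p(n)]` (`seqN`, `sel`, `cl_eq`) — enough for "infinitely
  often". The budget is polynomially bounded (`cl_le`), which is all `IsPPT` asks of it.
* **Verification makes the trials monotone.** `A'` runs `R(n) = t(n)·a(n)` trials (trial `kk` at
  position `kk mod t(n)` on the `kk`-th coin segment) and outputs the first *verified* preimage
  (`hits`, `f_eq_of_hits_eq_some`); the trials use disjoint coins, so the miss counts multiply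
  (`card_filter_allMiss`, `card_hits_none`).
* **No conditioning.** Eq. (2.8) and `Pr[U⁽ⁱ⁾ = x]·Pr[· | U⁽ⁱ⁾ = x]` become counting identities over
  the coin segments: overwriting block `i` by `x` is `2ⁿ`-to-one onto `{blk_i = x}` (`sum_ins_eq`,
  `two_pow_mul_card_filter_blk_eq`), the trial is invariant under it (`trial_ins`), and an honest
  success of `B'` is a hit of the trial whose instance is the `i`-th block
  (`trial_ne_none_of_succ`). Claim 2.3.2.2 is `card_succ_le`/`invertProb_g_le`/`density_good_ge`,
  Claim 2.3.2.1 is `pr_inv_ge_of_good`, the final display is `invertProb_f_ge`/`invertProb_f_gt`;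
  the analytic inputs are `(1 - 1/N)^{nN} ≤ e⁻ⁿ`, `(1 - 1/2Q)^{nQ} ≤ e^{-n/2}`
  (`Real.one_sub_div_pow_le_exp_neg`) and "polynomial × `e^{-cn}` → 0"
  (`eventually_natPoly_mul_exp_lt`).
* Parameters: `θinv(n) = 2t(n)M(n+1)^k` and `a(n) = n·θinv(n)` where `1/m^k` is the success bound of
  `B'` (`exists_frequently_ge_of_not_superpolynomialDecay`); print's `a(n) = 2n²p(n)q(n²p(n))`.

## Main definitions

* `Yao.Params` (`f, q, p`), `Params.T`, `Params.M`, `Params.nOf`, `Params.pad`, `blk`, `frames`, `ins`,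
  `Params.g` (the direct product), `splice` (the hybrid as a string surgery, `g_ins`);
* `Yao.Adv` (`B', k, q_B`), `Params.trial`, `Params.hits`, `Params.run`, `Params.inv` (the inverter
  `A'` as a `RandAlg`), `Params.cnt`, `Params.Good` (`S_n`), `Params.cl` (its coin budget);
* the named facts `yaoFun_polyTime`, `yaoRun_polyTime`.

## References

* A. C.-C. Yao, *Theory and applications of trapdoor functions*, FOCS 1982, 80–91.
* O. Goldreich, *Foundations of Cryptography I: Basic Tools*, CUP 2001, §2.3, Thm. 2.3.2 and its
  proof (§2.3.1, Claims 2.3.2.1–2.3.2.2, eqs. (2.5)–(2.8)); §2.2.3 (Prop. 2.2.3, eq. (2.3),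
  Prop. 2.2.5: length conventions).
* S. Arora, B. Barak, *Computational Complexity: A Modern Approach*, CUP 2009, §0.1 (pairing),
  §7.1 (probabilistic machines with a random tape).
-/

namespace Literature.Computability.Cryptography

open Filter Asymptotics _root_.Computability Complexity Finset

namespace Yao

/-! ### Parameters and the direct-product function -/

/-- The data of Yao's construction: the weak one-way function `f`, its hardness polynomial `q`
(every PPT inverter fails with probability `≥ 1/q(n)`), and a bound `p` on its output length
(`|f x| ≤ p(|x|)`). [Goldreich 2001, §2.3.1] [cite: Goldreich2001, Thm. 2.3.2 (proof)] -/
structure Params where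
  /-- the weak one-way function [folklore] -/
  f : List Bool → List Bool
  /-- the hardness polynomial: inverters fail with probability at least `1/q(n)` [folklore] -/
  q : Polynomial ℕ
  /-- output-length bound: `|f x| ≤ p |x|` [folklore] -/
  p : Polynomial ℕ

namespace Params

variable (P : Params)

/-- Number of blocks `t(n) = n · q(n)`. [Goldreich 2001, §2.3.1, eq. (2.5)] [cite: Goldreich2001, Thm. 2.3.2 (proof)] -/
def T (n : ℕ) : ℕ := n * P.q.eval n

/-- Designed input length `n · t(n) = n² q(n)` (the bits occupied by the blocks). [Goldreich 2001, §2.3.1] [cite: Goldreich2001, Thm. 2.3.2 (proof)] -/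
def M (n : ℕ) : ℕ := n * P.T n

/-- Block length used on inputs of length `m`: the largest `n ≤ m` with `n² q(n) ≤ m`. [folklore] -/
def nOf (m : ℕ) : ℕ := Nat.findGreatest (fun n => P.M n ≤ m) m

/-- Padding of `f`-images to the common length `p(n) + 1`: `y ↦ y 1 0^{p(n) - |y|}`.
[Goldreich 2001, §2.2.3.2, eq. (2.3)] [cite: Goldreich2001, Prop. 2.2.5] -/
def pad (n : ℕ) (y : List Bool) : List Bool := y ++ true :: List.replicate (P.p.eval n - y.length) false

/-- Width of one component `⟨pad_n y, ·⟩` in the output encoding: `2(p(n)+1) + 2`. [folklore] -/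
def cw (n : ℕ) : ℕ := 2 * (P.p.eval n + 1) + 2

end Params

/-- The `j`-th block of length `n` of `w` (the same slice `(w ⇂ jn) ↾ n` as `SISFunctionMachine.chk`;
a librarian may hoist it next to `frames`). [Goldreich 2001, §2.3.1] [cite: Goldreich2001, Thm. 2.3.2 (proof)] -/
def blk (n j : ℕ) (w : List Bool) : List Bool := (w.drop (j * n)).take n

/-- Overwriting the `i`-th block of length `n` by `x`. [Goldreich 2001, §2.3.1 (the hybrid input)] [folklore] -/
def ins (n i : ℕ) (x w : List Bool) : List Bool := w.take (i * n) ++ x ++ w.drop (i * n + n)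

namespace Params

variable (P : Params)

/-- The padded `f`-images of the first `T` blocks. [Goldreich 2001, §2.3.1, eq. (2.5)] [cite: Goldreich2001, Thm. 2.3.2 (proof)] -/
def comps (n T : ℕ) (w : List Bool) : List (List Bool) :=
  (List.range T).map fun j => P.pad n (P.f (blk n j w))

/-- **Yao's direct product** on all input lengths: on `w` of length `m`, with `n = nOf m` and
`t = t(n)`, output `⟨pad f(x₁), …, pad f(x_t), s⟩` where `x_j` are the consecutive `n`-bit blocks
and `s` the remaining suffix (passed through). [Yao 1982; Goldreich 2001, §2.3.1, eq. (2.5)]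
[cite: Goldreich2001, Thm. 2.3.2 (proof)] -/
def g (w : List Bool) : List Bool :=
  frames (P.comps (P.nOf w.length) (P.T (P.nOf w.length)) w ++ [w.drop (P.nOf w.length * P.T (P.nOf w.length))])

end Params

/-! ### Elementary lemmas -/

section Elementary

variable (P : Params)

/-- A block that fits inside the string has length `n`. [folklore] -/
theorem length_blk_of_le {n j : ℕ} {w : List Bool} (h : (j + 1) * n ≤ w.length) : (blk n j w).length = n := by
  simp only [blk, List.length_take, List.length_drop]
  rw [Nat.add_mul, one_mul] at h
  omega

/-- A block has length at most `n`. [folklore] -/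
theorem length_blk_le (n j : ℕ) (w : List Bool) : (blk n j w).length ≤ n := by
  simp [blk, List.length_take]

/-- **The framed code `frames` (`EncodingFrames.lean`) is injective** on lists of strings. [folklore] -/
theorem frames_injective : Function.Injective frames := by
  intro l
  induction l with
  | nil =>
    intro l' h
    cases l' with
    | nil => rfl
    | cons a l' => exact absurd h.symm (by simp)
  | cons a l ih =>
    intro l' h
    cases l' with
    | nil => exact absurd h (by simp)
    | cons a' l' =>
      rw [frames_cons_eq_boolPair, frames_cons_eq_boolPair] at h
      have h2 := boolPair_injective (a₁ := (a, frames l)) (a₂ := (a', frames l')) h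
      simp only [Prod.mk.injEq] at h2
      rw [h2.1, ih h2.2]

/-- Length of the framed code. [folklore] -/
theorem length_frames (l : List (List Bool)) : (frames l).length = (l.map fun a => 2 * a.length + 2).sum := by
  induction l with
  | nil => rfl
  | cons a l ih => rw [frames_cons_eq_boolPair, length_boolPair, ih, List.map_cons, List.sum_cons]

/-- Removing the padding: drop the trailing `0`s and the final `1`. [folklore] -/
def unpad (s : List Bool) : List Bool := ((s.reverse.dropWhile fun b => b == false).drop 1).reverse

/-- `unpad` is a left inverse of `pad n`. [folklore] -/
theorem unpad_pad (n : ℕ) (y : List Bool) : unpad (P.pad n y) = y := by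
  simp only [unpad, Params.pad, List.reverse_append, List.reverse_cons, List.reverse_replicate,
    List.append_assoc, List.singleton_append]
  rw [List.dropWhile_append_of_pos ?_]
  · simp
  · intro b hb
    rw [List.mem_replicate] at hb
    simp [hb.2]

/-- `pad n` is injective. [folklore] -/
theorem pad_injective (n : ℕ) : Function.Injective (P.pad n) := fun y y' h => by
  have := congrArg unpad h
  rwa [unpad_pad, unpad_pad] at this

/-- Padded images have the common length `p(n) + 1`. [Goldreich 2001, §2.2.3.2, eq. (2.3)] [folklore] -/
theorem length_pad {n : ℕ} {y : List Bool} (hy : y.length ≤ P.p.eval n) : (P.pad n y).length = P.p.eval n + 1 := by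
  simp [Params.pad]; omega

/-- `t` is positive for `n ≥ 1` when `q ≥ 1`. [folklore] -/
theorem T_pos {P : Params} (hq : ∀ n, 0 < P.q.eval n) {n : ℕ} (hn : 0 < n) : 0 < P.T n :=
  Nat.mul_pos hn (hq n)

/-- Evaluation of an `ℕ`-polynomial is monotone (private twin of `Literature.Computability.MetaComplexity.polynomial_eval_mono`,
`HeuristicClassesProofs.lean`). [folklore] -/
private theorem natPoly_eval_mono (p : Polynomial ℕ) {x y : ℕ} (hxy : x ≤ y) : p.eval x ≤ p.eval y := by
  induction p using Polynomial.induction_on' with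
  | add p q hp hq => simpa [Polynomial.eval_add] using Nat.add_le_add hp hq
  | monomial k a => simpa [Polynomial.eval_monomial] using Nat.mul_le_mul_left a (Nat.pow_le_pow_left hxy k)

/-- `t` is strictly increasing (for `q ≥ 1`). [folklore] -/
theorem T_strictMono {P : Params} (hq : ∀ n, 0 < P.q.eval n) : StrictMono P.T := by
  refine strictMono_nat_of_lt_succ fun n => ?_
  unfold Params.T
  calc n * P.q.eval n ≤ n * P.q.eval (n + 1) := Nat.mul_le_mul_left n (natPoly_eval_mono _ (Nat.le_succ n))
    _ < (n + 1) * P.q.eval (n + 1) := by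
      have := hq (n + 1); nlinarith

/-- `M` is strictly increasing (for `q ≥ 1`). [folklore] -/
theorem M_strictMono {P : Params} (hq : ∀ n, 0 < P.q.eval n) : StrictMono P.M := by
  refine strictMono_nat_of_lt_succ fun n => ?_
  unfold Params.M
  have h1 := T_strictMono hq (Nat.lt_succ_self n)
  have h2 : 0 < P.T (n + 1) := T_pos hq (Nat.succ_pos n)
  calc n * P.T n ≤ n * P.T (n + 1) := Nat.mul_le_mul_left n h1.le
    _ < (n + 1) * P.T (n + 1) := by nlinarith

/-- `n ≤ M n`. [folklore] -/
theorem le_M {P : Params} (hq : ∀ n, 0 < P.q.eval n) (n : ℕ) : n ≤ P.M n := by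
  rcases Nat.eq_zero_or_pos n with rfl | hn
  · simp
  · unfold Params.M
    exact Nat.le_mul_of_pos_right n (T_pos hq hn)

/-- Specification of `nOf`: `M (nOf m) ≤ m`. [folklore] -/
theorem M_nOf_le (m : ℕ) : P.M (P.nOf m) ≤ m := by
  have h : P.M 0 ≤ m := by simp [Params.M]
  exact Nat.findGreatest_spec (P := fun n => P.M n ≤ m) (Nat.zero_le m) h

/-- Specification of `nOf`: `m < M (nOf m + 1)` (for `q ≥ 1`). [folklore] -/
theorem lt_M_nOf_succ {P : Params} (hq : ∀ n, 0 < P.q.eval n) (m : ℕ) : m < P.M (P.nOf m + 1) := by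
  by_contra h
  push Not at h
  have hle : P.nOf m + 1 ≤ m := (le_M hq _).trans h
  have := Nat.le_findGreatest (P := fun n => P.M n ≤ m) hle h
  unfold Params.nOf at this
  omega

/-- `nOf` inverts `M` on the designed ranges: `M n ≤ m < M (n+1)` gives `nOf m = n`. [folklore] -/
theorem nOf_eq {P : Params} (hq : ∀ n, 0 < P.q.eval n) {n m : ℕ} (h1 : P.M n ≤ m) (h2 : m < P.M (n + 1)) : P.nOf m = n := by
  have hmono := M_strictMono hq
  have ha : P.M (P.nOf m) ≤ m := M_nOf_le P m
  have hb : m < P.M (P.nOf m + 1) := lt_M_nOf_succ hq m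
  have h3 : P.nOf m < n + 1 := hmono.lt_iff_lt.1 (ha.trans_lt h2)
  have h4 : n < P.nOf m + 1 := hmono.lt_iff_lt.1 (h1.trans_lt hb)
  omega

/-- `nOf (M n) = n`. [folklore] -/
theorem nOf_M {P : Params} (hq : ∀ n, 0 < P.q.eval n) (n : ℕ) : P.nOf (P.M n) = n :=
  nOf_eq hq le_rfl (M_strictMono hq (Nat.lt_succ_self n))

/-- `nOf m → ∞`. [folklore] -/
theorem tendsto_nOf {P : Params} (hq : ∀ n, 0 < P.q.eval n) : Tendsto P.nOf atTop atTop := by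
  refine tendsto_atTop_atTop.2 fun n => ⟨P.M n, fun m hm => ?_⟩
  by_contra h
  push Not at h
  have hb := lt_M_nOf_succ hq m
  have : P.M (P.nOf m + 1) ≤ P.M n := (M_strictMono hq).monotone (by omega)
  omega

end Elementary

/-! ### Block surgery -/

section Surgery

variable (P : Params)

/-- Overwriting a block preserves the length. [folklore] -/
theorem length_ins {n i : ℕ} {x w : List Bool} (hx : x.length = n) (hw : (i + 1) * n ≤ w.length) :
    (ins n i x w).length = w.length := by
  simp only [ins, List.length_append, List.length_take, List.length_drop, hx]
  rw [Nat.add_mul, one_mul] at hw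
  omega

/-- The overwritten block reads back. [folklore] -/
theorem blk_ins_self {n i : ℕ} {x w : List Bool} (hx : x.length = n) (hw : (i + 1) * n ≤ w.length) :
    blk n i (ins n i x w) = x := by
  rw [Nat.add_mul, one_mul] at hw
  have ht : (w.take (i * n)).length = i * n := by simp; omega
  simp only [blk, ins, List.append_assoc]
  rw [List.drop_append_of_le_length ht.ge, List.drop_eq_nil_of_le ht.le, List.nil_append,
    List.take_append_of_le_length hx.ge, ← hx, List.take_length]

/-- Overwriting block `i` does not change the string beyond it. [folklore] -/
theorem drop_ins_of_le {n i k : ℕ} {x w : List Bool} (hx : x.length = n) (hw : (i + 1) * n ≤ w.length)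
    (hk : (i + 1) * n ≤ k) : (ins n i x w).drop k = w.drop k := by
  rw [Nat.add_mul, one_mul] at hw hk
  have ht : (w.take (i * n) ++ x).length = i * n + n := by simp [hx]; omega
  simp only [ins]
  rw [List.drop_append, ht, List.drop_eq_nil_of_le (as := w.take (i * n) ++ x) (by omega), List.nil_append,
    List.drop_drop]
  congr 1
  omega

/-- Overwriting block `i` commutes with taking a prefix containing it. [folklore] -/
theorem take_ins_of_le {n i k : ℕ} {x w : List Bool} (hx : x.length = n) (hw : (i + 1) * n ≤ w.length)
    (hk : (i + 1) * n ≤ k) : (ins n i x w).take k = ins n i x (w.take k) := by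
  rw [Nat.add_mul, one_mul] at hw hk
  have ht : (w.take (i * n) ++ x).length = i * n + n := by simp [hx]; omega
  simp only [ins]
  rw [List.take_append, ht, List.take_of_length_le (l := w.take (i * n) ++ x) (by rw [ht]; omega),
    List.take_take, min_eq_left (by omega : i * n ≤ k), List.drop_take, List.append_assoc]

/-- Unfolding of `blk`. [folklore] -/
theorem blk_eq_take_drop (n j : ℕ) (w : List Bool) : blk n j w = (w.drop (j * n)).take n := rfl

/-- Overwriting block `i` does not change the earlier blocks. [folklore] -/
theorem blk_ins_of_lt {n i j : ℕ} {x w : List Bool} (hw : (i + 1) * n ≤ w.length)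
    (hj : j < i) : blk n j (ins n i x w) = blk n j w := by
  have hjn : (j + 1) * n ≤ i * n := Nat.mul_le_mul_right n hj
  rw [Nat.add_mul, one_mul] at hw hjn
  simp only [blk, ins, List.append_assoc]
  rw [List.drop_append_of_le_length (by simp; omega : j * n ≤ (w.take (i * n)).length),
    List.take_append_of_le_length (by simp; omega : n ≤ ((w.take (i * n)).drop (j * n)).length),
    List.drop_take, List.take_take, min_eq_left (by omega : n ≤ i * n - j * n)]

/-- Overwriting block `i` does not change the later blocks. [folklore] -/
theorem blk_ins_of_gt {n i j : ℕ} {x w : List Bool} (hx : x.length = n) (hw : (i + 1) * n ≤ w.length)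
    (hj : i < j) : blk n j (ins n i x w) = blk n j w := by
  have hjn : (i + 1) * n ≤ j * n := Nat.mul_le_mul_right n hj
  have h1 : (ins n i x w).drop (j * n) = ((ins n i x w).drop ((i + 1) * n)).drop (j * n - (i + 1) * n) := by
    rw [List.drop_drop]; congr 1; omega
  have h2 : w.drop (j * n) = (w.drop ((i + 1) * n)).drop (j * n - (i + 1) * n) := by
    rw [List.drop_drop]; congr 1; omega
  simp only [blk]
  rw [h1, h2, drop_ins_of_le hx hw le_rfl]

/-- Overwriting a block by itself is the identity. [folklore] -/
theorem ins_blk_self (n i : ℕ) (w : List Bool) : ins n i (blk n i w) w = w := by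
  simp only [ins, blk]
  conv_rhs => rw [← List.take_append_drop (i * n) w, ← List.take_append_drop n (w.drop (i * n))]
  rw [List.drop_drop, List.append_assoc]

/-- Overwriting the same block twice. [folklore] -/
theorem ins_ins {n i : ℕ} {x v w : List Bool} (hv : v.length = n) (hw : (i + 1) * n ≤ w.length) :
    ins n i x (ins n i v w) = ins n i x w := by
  have hd := drop_ins_of_le hv hw le_rfl
  rw [Nat.add_mul, one_mul] at hw hd
  simp only [ins] at hd ⊢
  rw [hd]
  congr 1
  rw [List.append_assoc, List.take_append_of_le_length (by simp; omega : i * n ≤ (w.take (i * n)).length),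
    List.take_take, min_self]

/-- The components of a hybrid input: the `i`-th is replaced. [Goldreich 2001, §2.3.1] [folklore] -/
theorem comps_ins {n i T : ℕ} {x w : List Bool} (hx : x.length = n) (hi : i < T) (hw : T * n ≤ w.length) :
    P.comps n T (ins n i x w) = (P.comps n T w).set i (P.pad n (P.f x)) := by
  have hw' : (i + 1) * n ≤ w.length := (Nat.mul_le_mul_right n hi).trans hw
  apply List.ext_getElem
  · simp [Params.comps]
  · intro j h1 h2
    simp only [Params.comps, List.getElem_map, List.getElem_range, List.length_map, List.length_range] at h1 h2 ⊢
    rw [List.getElem_set]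
    split_ifs with hij
    · subst hij; rw [blk_ins_self hx hw']
    · simp only [List.getElem_map, List.getElem_range]
      rcases lt_or_gt_of_ne (Ne.symm hij) with h | h
      · rw [blk_ins_of_lt hw' h]
      · rw [blk_ins_of_gt hx hw' h]

/-- Length of the framed code of equal-length components. [folklore] -/
theorem length_frames_of_forall {l : List (List Bool)} {L : ℕ} (h : ∀ a ∈ l, a.length = L) :
    (frames l).length = l.length * (2 * L + 2) := by
  induction l with
  | nil => simp
  | cons a l ih =>
    rw [frames_cons_eq_boolPair, length_boolPair, ih fun b hb => h b (List.mem_cons_of_mem a hb), h a (List.mem_cons_self ..),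
      List.length_cons]
    ring

/-- String surgery on the pair encoding: replace the `i`-th component of width `cw`. [folklore] -/
def splice (G : List Bool) (i cw : ℕ) (c : List Bool) : List Bool := G.take (i * cw) ++ boolPair c (G.drop ((i + 1) * cw))

/-- `splice` replaces the `i`-th component of the framed code of a list whose first `i+1`
components have width `2L+2`. [folklore] -/
theorem splice_frames {l : List (List Bool)} {L i : ℕ} (h : ∀ j (hj : j < l.length), j ≤ i → (l[j]).length = L)
    (hi : i < l.length) (c : List Bool) : splice (frames l) i (2 * L + 2) c = frames (l.set i c) := by
  have hsplit : l = l.take i ++ l[i] :: l.drop (i + 1) := by simp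
  have hlen1 : ∀ a ∈ l.take i, a.length = L := by
    intro a ha
    obtain ⟨j, hj, rfl⟩ := List.getElem_of_mem ha
    rw [List.length_take] at hj
    rw [List.getElem_take]
    exact h j (by omega) (by omega)
  have hti : (l.take i).length = i := by simp; omega
  have hE1 : (frames (l.take i)).length = i * (2 * L + 2) := by rw [length_frames_of_forall hlen1, hti]
  have hE2 : (frames (l.take i ++ [l[i]])).length = (i + 1) * (2 * L + 2) := by
    rw [length_frames_of_forall, List.length_append, hti, List.length_singleton]
    intro a ha
    rcases List.mem_append.1 ha with ha | ha
    · exact hlen1 a ha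
    · rw [List.mem_singleton.1 ha]; exact h i hi le_rfl
  have hset : l.set i c = l.take i ++ c :: l.drop (i + 1) := by
    conv_lhs => rw [hsplit]
    rw [List.set_append_right _ _ (by omega), hti, Nat.sub_self, List.set_cons_zero]
  rw [hset]
  conv_lhs => rw [hsplit]
  rw [splice, frames_append, frames_append, frames_cons_eq_boolPair, frames_cons_eq_boolPair, List.take_append_of_le_length hE1.ge,
    List.take_of_length_le hE1.le]
  congr 1
  have : l.take i ++ l[i] :: l.drop (i + 1) = (l.take i ++ [l[i]]) ++ l.drop (i + 1) := by simp
  rw [← frames_cons_eq_boolPair, ← frames_append, this, frames_append, List.drop_append_of_le_length hE2.ge,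
    List.drop_eq_nil_of_le hE2.le, List.nil_append]

variable {P}

/-- All components of `comps` have the padded length when `|f x| ≤ p |x|` and the blocks are full. [folklore] -/
theorem length_of_mem_comps (hp : ∀ x, (P.f x).length ≤ P.p.eval x.length) {n T : ℕ} {w : List Bool}
    (hw : T * n ≤ w.length) {a : List Bool} (ha : a ∈ P.comps n T w) : a.length = P.p.eval n + 1 := by
  simp only [Params.comps, List.mem_map, List.mem_range] at ha
  obtain ⟨j, hj, rfl⟩ := ha
  have hb : (blk n j w).length = n := length_blk_of_le ((Nat.mul_le_mul_right n hj).trans hw)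
  apply length_pad
  have := hp (blk n j w)
  rwa [hb] at this

/-- `comps` has `T` components. [folklore] -/
theorem length_comps (n T : ℕ) (w : List Bool) : (P.comps n T w).length = T := by simp [Params.comps]

/-- **Length-regularity of `g`.** [Goldreich 2001, §2.2.3.2] [folklore] -/
theorem length_g (hp : ∀ x, (P.f x).length ≤ P.p.eval x.length) (w : List Bool) :
    (P.g w).length = P.T (P.nOf w.length) * P.cw (P.nOf w.length)
      + (2 * (w.length - P.nOf w.length * P.T (P.nOf w.length)) + 2) := by
  have hw : P.T (P.nOf w.length) * P.nOf w.length ≤ w.length := by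
    rw [mul_comm]; exact M_nOf_le P w.length
  rw [Params.g, frames_append, List.length_append, length_frames_of_forall (fun a ha => length_of_mem_comps hp hw ha),
    length_comps, frames_cons_eq_boolPair, frames_nil, length_boolPair, List.length_drop, List.length_nil, Params.cw]

/-- **The hybrid is a surgery on the encoding**: `g(ins_i x w) = splice (g w) i cw (pad (f x))`.
[Goldreich 2001, §2.3.1 (step 2 of procedure `I`)] [folklore] -/
theorem g_ins (hp : ∀ x, (P.f x).length ≤ P.p.eval x.length) {n i : ℕ} {x w : List Bool} (hx : x.length = n)
    (hn : P.nOf w.length = n) (hi : i < P.T n) :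
    P.g (ins n i x w) = splice (P.g w) i (P.cw n) (P.pad n (P.f x)) := by
  have hw : P.T n * n ≤ w.length := by rw [mul_comm, ← hn]; exact M_nOf_le P w.length
  have hw' : (i + 1) * n ≤ w.length := (Nat.mul_le_mul_right n hi).trans hw
  have hlen : (ins n i x w).length = w.length := length_ins hx hw'
  rw [Params.g, Params.g, hlen, hn, comps_ins P hx hi hw,
    drop_ins_of_le hx hw' (by rw [Nat.mul_comm n]; exact Nat.mul_le_mul_right n hi), Params.cw]
  have hL : ∀ j (hj : j < (P.comps n (P.T n) w ++ [w.drop (n * P.T n)]).length), j ≤ i →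
      ((P.comps n (P.T n) w ++ [w.drop (n * P.T n)])[j]).length = P.p.eval n + 1 := by
    intro j hj hji
    have hjT : j < (P.comps n (P.T n) w).length := by rw [length_comps]; omega
    rw [List.getElem_append_left hjT]
    exact length_of_mem_comps hp hw (List.getElem_mem hjT)
  rw [splice_frames hL (by simp [length_comps]; omega), List.set_append_left _ _ (by rw [length_comps]; exact hi)]

/-- **A `g`-preimage of a hybrid yields an `f`-preimage in block `i`.** If `g z = g (ins_i x w)` then
`f (blk n i z) = f x` (the block read at length `n`): by injectivity of the list encoding the
numbers of components agree, so `t(n_z) = t(n)` and `n_z = n` (`t` is strictly increasing), and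
the `i`-th padded components agree. [Goldreich 2001, §2.3.1 ("any success of `B'` to invert `g`
means that `f` was inverted on the `i`th block")] [cite: Goldreich2001, Thm. 2.3.2 (proof)] -/
theorem f_blk_eq_of_g_eq (hq : ∀ n, 0 < P.q.eval n) {n i : ℕ} {x w z : List Bool} (hx : x.length = n)
    (hn : P.nOf w.length = n) (hi : i < P.T n) (hz : P.g z = P.g (ins n i x w)) : P.f (blk n i z) = P.f x := by
  have hw : P.T n * n ≤ w.length := by rw [mul_comm, ← hn]; exact M_nOf_le P w.length
  have hw' : (i + 1) * n ≤ w.length := (Nat.mul_le_mul_right n hi).trans hw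
  have hlen : (ins n i x w).length = w.length := length_ins hx hw'
  rw [Params.g, Params.g, hlen, hn] at hz
  have hinj := frames_injective hz
  have hl := congrArg List.length hinj
  simp only [List.length_append, length_comps, List.length_singleton, Nat.add_right_cancel_iff] at hl
  have hnz : P.nOf z.length = n := (T_strictMono hq).injective hl
  rw [hnz] at hinj
  have hc : P.comps n (P.T n) z = P.comps n (P.T n) (ins n i x w) := List.append_inj_left' hinj rfl
  rw [comps_ins P hx hi hw] at hc
  have hget := List.getElem_of_eq hc (by rw [length_comps]; exact hi)
  simp only [Params.comps, List.getElem_map, List.getElem_range, List.getElem_set_self] at hget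
  exact pad_injective P n hget

end Surgery

/-! ### Counting over coin strings read as consecutive fields -/

section Counting

/-- Splitting a sum of natural numbers over `{0,1}^{a+b}` into the iterated sum over the two fields
(the `ℕ`-valued case of `LiuPassPadding.sum_vector_add`, a file downstream of S05 in content and
therefore not imported here). [folklore] -/
theorem sum_split_fields (a b : ℕ) (φ : List Bool → List Bool → ℕ) :
    ∑ v : List.Vector Bool (a + b), φ (v.toList.take a) (v.toList.drop a) =
      ∑ u : List.Vector Bool a, ∑ w : List.Vector Bool b, φ u.toList w.toList := by
  rw [← Finset.sum_product']
  refine Finset.sum_bij' (fun v _ => ((⟨v.toList.take a, by simp⟩ : List.Vector Bool a), (⟨v.toList.drop a, by simp⟩ : List.Vector Bool b)))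
    (fun q _ => (⟨q.1.toList ++ q.2.toList, by simp⟩ : List.Vector Bool (a + b))) ?_ ?_ ?_ ?_ ?_
  · intro v _; simp
  · intro q _; simp
  · intro v _
    exact Subtype.ext (List.take_append_drop a v.toList)
  · intro q _
    obtain ⟨⟨u, hu⟩, ⟨w, hw⟩⟩ := q
    simp only [List.Vector.toList_mk, Prod.mk.injEq]
    exact ⟨Subtype.ext (List.take_left' hu), Subtype.ext (List.drop_left' hu)⟩
  · intro v _
    simp [List.Vector.toList_mk]

/-- **Product rule**: the number of strings of length `a + b` whose first field satisfies `Pa` and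
whose second field satisfies `Qb` is the product of the two counts. [folklore] -/
theorem card_filter_take_drop (a b : ℕ) (Pa Qb : List Bool → Prop) [DecidablePred Pa] [DecidablePred Qb] :
    (univ.filter fun v : List.Vector Bool (a + b) => Pa (v.toList.take a) ∧ Qb (v.toList.drop a)).card =
      (univ.filter fun u : List.Vector Bool a => Pa u.toList).card *
        (univ.filter fun w : List.Vector Bool b => Qb w.toList).card := by
  rw [Finset.card_filter, Finset.card_filter, Finset.card_filter,
    sum_split_fields a b (fun u w => if Pa u ∧ Qb w then 1 else 0), Finset.sum_mul_sum]
  refine Finset.sum_congr rfl fun u _ => Finset.sum_congr rfl fun w _ => ?_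
  by_cases h1 : Pa u.toList <;> by_cases h2 : Qb w.toList <;> simp [h1, h2]

/-- Summing a count over the first field:
`Σ_{u ∈ {0,1}^a} #{w ∈ {0,1}^b : R u w} = #{v ∈ {0,1}^{a+b} : R (v↾a) (v⇂a)}`. [folklore] -/
theorem sum_card_filter_eq_card (a b : ℕ) (Rel : List Bool → List Bool → Prop) [∀ u, DecidablePred (Rel u)] :
    ∑ u : List.Vector Bool a, (univ.filter fun w : List.Vector Bool b => Rel u.toList w.toList).card =
      (univ.filter fun v : List.Vector Bool (a + b) => Rel (v.toList.take a) (v.toList.drop a)).card := by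
  rw [Finset.card_filter, sum_split_fields a b (fun u w => if Rel u w then 1 else 0)]
  refine Finset.sum_congr rfl fun u _ => ?_
  rw [Finset.card_filter]

/-- Block `0` is the prefix. [folklore] -/
theorem blk_zero (n : ℕ) (w : List Bool) : blk n 0 w = w.take n := by simp [blk]

/-- Block `j+1` is block `j` of the tail. [folklore] -/
theorem blk_succ (n j : ℕ) (w : List Bool) : blk n (j + 1) w = blk n j (w.drop n) := by
  simp only [blk, List.drop_drop]
  congr 2
  ring

/-- Transport of a count along an equality of lengths. [folklore] -/
theorem card_filter_vector_congr {a b : ℕ} (hab : a = b) (Q : List Bool → Prop) [DecidablePred Q] :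
    (univ.filter fun v : List.Vector Bool a => Q v.toList).card = (univ.filter fun v : List.Vector Bool b => Q v.toList).card := by
  subst hab; rfl

/-- **Independent blocks**: the number of strings of length `n·T + e` all of whose `T` leading
`n`-blocks lie in `S` is `|S|^T · 2^e`. [Goldreich 2001, §2.3.1 (`s₂(n) ≤ Pr[∀ i : U⁽ⁱ⁾ ∈ Sₙ]`)]
[cite: Goldreich2001, Thm. 2.3.2 (proof)] -/
theorem card_filter_forall_blk (n : ℕ) (S : List Bool → Prop) [DecidablePred S] :
    ∀ (T e : ℕ), (univ.filter fun v : List.Vector Bool (n * T + e) => ∀ i < T, S (blk n i v.toList)).card =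
      (univ.filter fun u : List.Vector Bool n => S u.toList).card ^ T * 2 ^ e
  | 0, e => by simp [card_vector]
  | T + 1, e => by
    have hlen : n * (T + 1) + e = n + (n * T + e) := by ring
    rw [card_filter_vector_congr hlen (fun w => ∀ i < T + 1, S (blk n i w))]
    have h := card_filter_take_drop n (n * T + e) S (fun w => ∀ i < T, S (blk n i w))
    rw [card_filter_forall_blk n S T e] at h
    calc (univ.filter fun v : List.Vector Bool (n + (n * T + e)) => ∀ i < T + 1, S (blk n i v.toList)).card
        = (univ.filter fun v : List.Vector Bool (n + (n * T + e)) =>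
            S (v.toList.take n) ∧ ∀ i < T, S (blk n i (v.toList.drop n))).card := by
          congr 1
          ext v
          simp only [Finset.mem_filter, Finset.mem_univ, true_and]
          constructor
          · intro hv
            refine ⟨by simpa [blk_zero] using hv 0 (Nat.succ_pos T), fun i hi => ?_⟩
            rw [← blk_succ]
            exact hv (i + 1) (by omega)
          · rintro ⟨h0, hs⟩ i hi
            rcases i with _ | i
            · simpa [blk_zero] using h0
            · rw [blk_succ]; exact hs i (by omega)
      _ = _ := by rw [h]; ring

variable {n i c : ℕ} {x : List Bool}

/-- **Averaging over the overwritten block**: `Σ_σ h(ins_i x σ) = 2ⁿ · Σ_{σ : blk_i σ = x} h(σ)`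
(the map `σ ↦ ins_i x σ` is `2ⁿ`-to-one onto `{blk_i = x}`). [Goldreich 2001, §2.3.1
(`Pr[U⁽ⁱ⁾ = x] · Pr[· | U⁽ⁱ⁾ = x]`)] [cite: Goldreich2001, Thm. 2.3.2 (proof)] -/
theorem sum_ins_eq (hx : x.length = n) (hc : (i + 1) * n ≤ c) (h : List Bool → ℝ) :
    ∑ σ : List.Vector Bool c, h (ins n i x σ.toList) =
      2 ^ n * ∑ σ ∈ univ.filter (fun σ : List.Vector Bool c => blk n i σ.toList = x), h σ.toList := by
  classical
  have hcσ : ∀ σ : List.Vector Bool c, (i + 1) * n ≤ σ.toList.length := fun σ => by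
    rw [List.Vector.toList_length]; exact hc
  have hlen : ∀ (v : List Bool) (σ : List.Vector Bool c), v.length = n → (ins n i v σ.toList).length = c :=
    fun v σ hv => by rw [length_ins hv (hcσ σ), List.Vector.toList_length]
  have hR : (2 : ℝ) ^ n * ∑ σ ∈ univ.filter (fun σ : List.Vector Bool c => blk n i σ.toList = x), h σ.toList =
      ∑ q ∈ (univ : Finset (List.Vector Bool n)) ×ˢ univ.filter (fun σ : List.Vector Bool c => blk n i σ.toList = x),
        h q.2.toList := by
    simp only [Finset.sum_product, Finset.sum_const, Finset.card_univ, card_vector, Fintype.card_bool, nsmul_eq_mul]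
    push_cast
    ring
  rw [hR]
  refine Finset.sum_bij' (fun σ _ => ((⟨blk n i σ.toList, length_blk_of_le (hcσ σ)⟩ : List.Vector Bool n),
      (⟨ins n i x σ.toList, hlen x σ hx⟩ : List.Vector Bool c)))
    (fun q _ => (⟨ins n i q.1.toList q.2.toList, hlen _ _ q.1.toList_length⟩ : List.Vector Bool c)) ?_ ?_ ?_ ?_ ?_
  · intro σ _
    simp only [Finset.mem_product, Finset.mem_univ, true_and, Finset.mem_filter, List.Vector.toList_mk]
    exact blk_ins_self hx (hcσ σ)
  · intro q _; exact Finset.mem_univ _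
  · intro σ _
    apply Subtype.ext
    show ins n i (blk n i σ.toList) (ins n i x σ.toList) = σ.toList
    rw [ins_ins hx (hcσ σ), ins_blk_self]
  · intro q hq
    simp only [Finset.mem_product, Finset.mem_univ, true_and, Finset.mem_filter] at hq
    obtain ⟨v, τ⟩ := q
    simp only at hq
    refine Prod.ext (Subtype.ext ?_) (Subtype.ext ?_)
    · show blk n i (ins n i v.toList τ.toList) = v.toList
      exact blk_ins_self v.toList_length (hcσ τ)
    · show ins n i x (ins n i v.toList τ.toList) = τ.toList
      rw [ins_ins v.toList_length (hcσ τ)]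
      conv_rhs => rw [← ins_blk_self n i τ.toList]
      rw [hq]
  · intro σ _; rfl

/-- Corollary: for an `ins_i x`-invariant event, `2ⁿ · #{σ : blk_i σ = x ∧ E σ} = #{σ : E σ}`. [folklore] -/
theorem two_pow_mul_card_filter_blk_eq (hx : x.length = n) (hc : (i + 1) * n ≤ c) (E : List Bool → Prop) [DecidablePred E]
    (hE : ∀ σ : List.Vector Bool c, E (ins n i x σ.toList) ↔ E σ.toList) :
    2 ^ n * (univ.filter fun σ : List.Vector Bool c => blk n i σ.toList = x ∧ E σ.toList).card =
      (univ.filter fun σ : List.Vector Bool c => E σ.toList).card := by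
  classical
  have h := sum_ins_eq hx hc (fun w => if E w then (1 : ℝ) else 0)
  simp only [hE] at h
  rw [Finset.sum_boole, Finset.sum_filter] at h
  have h2 : (∑ σ : List.Vector Bool c, if blk n i σ.toList = x then (if E σ.toList then (1 : ℝ) else 0) else 0) =
      ((univ.filter fun σ : List.Vector Bool c => blk n i σ.toList = x ∧ E σ.toList).card : ℝ) := by
    rw [← Finset.sum_boole]
    refine Finset.sum_congr rfl fun σ _ => ?_
    by_cases h1 : blk n i σ.toList = x <;> by_cases h2 : E σ.toList <;> simp [h1, h2]
  rw [h2] at h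
  exact_mod_cast h.symm

end Counting

/-! ### The inverter `A'` (Goldreich's procedure `I`, repeated) -/

/-- The data of a prospective `g`-inverter: a PPT `B'`, the exponent `k` of its success bound
`1/m^k` (on infinitely many `m`), and a polynomial bound `q_B` on its coin budget.
[Goldreich 2001, §2.3.1, eq. (2.6)] [cite: Goldreich2001, Thm. 2.3.2 (proof)] -/
structure Adv where
  /-- the `g`-inverter [folklore] -/
  B : RandAlg (List Bool) (List Bool)
  /-- success exponent: `1/m^k ≤ Pr[B' inverts g on U_m]` for infinitely many `m` [folklore] -/
  k : ℕ
  /-- coin bound of `B'`: `B.coinLen ℓ ≤ q_B ℓ` [folklore] -/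
  qB : Polynomial ℕ

section Inverter

open Polynomial

namespace Params

variable (P : Params) (A : Adv)

/-- `t` as a polynomial: `X · q`. [folklore] -/
noncomputable def Tpoly : Polynomial ℕ := X * P.q
/-- `M` as a polynomial: `X · t`. [folklore] -/
noncomputable def Mpoly : Polynomial ℕ := X * P.Tpoly
/-- `M(n+1)` as a polynomial. [folklore] -/
noncomputable def M1poly : Polynomial ℕ := P.Mpoly.comp (X + 1)
/-- The component width as a polynomial: `2(p+1)+2`. [folklore] -/
noncomputable def cwpoly : Polynomial ℕ := C 2 * (P.p + 1) + C 2
/-- Upper bound on the length of `B'`'s queries at block length `n`, as a polynomial. [folklore] -/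
noncomputable def QLpoly : Polynomial ℕ :=
  C 2 * (P.Mpoly + P.M1poly) + C 2 + (P.Tpoly * P.cwpoly + (C 2 * P.M1poly + C 2))
/-- Strict upper bound `K_b(n)` on `B'`'s coin count on its queries, as a polynomial. [folklore] -/
noncomputable def Kpoly : Polynomial ℕ := A.qB.comp P.QLpoly + 1
/-- The modulus `Base(n) = M(n+1) · K_b(n)` of the advice encoding, as a polynomial. [folklore] -/
noncomputable def Bpoly : Polynomial ℕ := P.M1poly * P.Kpoly A
/-- `1/θ(n) = 2 t(n) M(n+1)^k`: the inverse of the threshold defining the good set `S_n`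
(Goldreich's `a(n)/n`). [Goldreich 2001, §2.3.1 (definition of `S_n`)] [cite: Goldreich2001, Thm. 2.3.2 (proof)] -/
def θinv (n : ℕ) : ℕ := 2 * P.T n * P.M (n + 1) ^ A.k
/-- Repetitions per position, `n/θ(n)` (Goldreich's `a(n)`). [Goldreich 2001, §2.3.1] [cite: Goldreich2001, Thm. 2.3.2 (proof)] -/
def reps (n : ℕ) : ℕ := n * P.θinv A n
/-- Total number of trials `t(n) · a(n)`. [Goldreich 2001, §2.3.1] [cite: Goldreich2001, Thm. 2.3.2 (proof)] -/
def R (n : ℕ) : ℕ := P.T n * P.reps A n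
/-- The number of trials as a polynomial (the clock of the loop). [folklore] -/
noncomputable def Rpoly : Polynomial ℕ := P.Tpoly * (X * (C 2 * P.Tpoly * P.M1poly ^ A.k))
/-- `K_b(n)`. [folklore] -/
noncomputable def Kb (n : ℕ) : ℕ := (P.Kpoly A).eval n
/-- `Base(n)`. [folklore] -/
noncomputable def Base (n : ℕ) : ℕ := (P.Bpoly A).eval n
/-- Length of `B'`'s query `⟨1^m, g(w)⟩` for `|w| = m = M n + idx`. [folklore] -/
def QL (n idx : ℕ) : ℕ := 2 * (P.M n + idx) + 2 + (P.T n * P.cw n + (2 * idx + 2))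

/-- `Tpoly` evaluates to `t`. [folklore] -/
@[simp] theorem eval_Tpoly (n : ℕ) : P.Tpoly.eval n = P.T n := by simp [Tpoly, Params.T]
/-- `Mpoly` evaluates to `M`. [folklore] -/
@[simp] theorem eval_Mpoly (n : ℕ) : P.Mpoly.eval n = P.M n := by simp [Mpoly, Params.M]
/-- `M1poly` evaluates to `M (n+1)`. [folklore] -/
@[simp] theorem eval_M1poly (n : ℕ) : P.M1poly.eval n = P.M (n + 1) := by simp [M1poly, eval_comp]
/-- `cwpoly` evaluates to `cw`. [folklore] -/
@[simp] theorem eval_cwpoly (n : ℕ) : P.cwpoly.eval n = P.cw n := by simp [cwpoly, Params.cw]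
/-- `QLpoly` evaluates to the query length at the largest `idx`. [folklore] -/
@[simp] theorem eval_QLpoly (n : ℕ) : P.QLpoly.eval n = P.QL n (P.M (n + 1)) := by
  simp [QLpoly, QL]
/-- Unfolding of `K_b`. [folklore] -/
theorem Kb_eq (n : ℕ) : P.Kb A n = A.qB.eval (P.QL n (P.M (n + 1))) + 1 := by simp [Kb, Kpoly, eval_comp]
/-- Unfolding of `Base`. [folklore] -/
theorem Base_eq (n : ℕ) : P.Base A n = P.M (n + 1) * P.Kb A n := by simp [Base, Bpoly, Kb]
/-- `Rpoly` evaluates to `R`. [folklore] -/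
@[simp] theorem eval_Rpoly (n : ℕ) : (P.Rpoly A).eval n = P.R A n := by
  simp [Rpoly, R, reps, θinv]

/-- `K_b > 0`. [folklore] -/
theorem Kb_pos (n : ℕ) : 0 < P.Kb A n := by rw [Kb_eq]; exact Nat.succ_pos _

/-- **One trial** at position `i` on a coin segment `seg = w ‖ r_B` (`|w| = m`): query `B'` on the
hybrid `⟨1^m, splice (g w) i (pad y)⟩ = ⟨1^m, g(ins_i x w)⟩` with coins `r_B`, read the `i`-th
block of the answer and keep it iff it is an `f`-preimage of `y`. [Goldreich 2001, §2.3.1,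
procedure `I`, steps 1–3] [cite: Goldreich2001, Thm. 2.3.2 (proof)] -/
def trial (n m i : ℕ) (y seg : List Bool) : Option (List Bool) :=
  if P.f (blk n i (A.B.run (boolPair (unaryEncodeNat m) (splice (P.g (seg.take m)) i (P.cw n) (P.pad n y))) (seg.drop m))) = y
  then some (blk n i (A.B.run (boolPair (unaryEncodeNat m) (splice (P.g (seg.take m)) i (P.cw n) (P.pad n y))) (seg.drop m)))
  else none

end Params

/-- The `kk`-th coin segment of width `c` (again the slice of `SISFunctionMachine.chk`). [folklore] -/
def sgt (c kk : ℕ) (r : List Bool) : List Bool := (r.drop (kk * c)).take c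

namespace Params

variable (P : Params) (A : Adv)

/-- The trials of `A'` on `⟨1ⁿ, y⟩` with target length `m` and segment width `c`: trial `kk < R(n)`
at position `kk mod t(n)` on the `kk`-th coin segment; the first hit. [Goldreich 2001, §2.3.1
(algorithm `A'`: procedure `I` repeated `a(n)` times)] [cite: Goldreich2001, Thm. 2.3.2 (proof)] -/
def hits (n m c : ℕ) (y r : List Bool) : Option (List Bool) :=
  (List.range (P.R A n)).findSome? fun kk => P.trial A n m (kk % P.T n) y (sgt c kk r)

/-- **The run function of `A'`.** The target length `m = M(n) + idx` and `B'`'s coin count `κ` are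
decoded from the *number* of coins: `|r| mod Base(n) = idx · K_b(n) + κ` (the analogue, in the
tree's model of probabilistic machines with a prescribed coin budget, of print's advice-free
choice "all `m` of the form `n²p(n)`" — see the module docstring). Output: the first verified
preimage, else `ε`. [Goldreich 2001, §2.3.1] [cite: Goldreich2001, Thm. 2.3.2 (proof)] -/
noncomputable def run (inp r : List Bool) : List Bool :=
  (P.hits A (boolUnpair inp).1.length
      (P.M (boolUnpair inp).1.length + r.length % P.Base A (boolUnpair inp).1.length / P.Kb A (boolUnpair inp).1.length)
      (P.M (boolUnpair inp).1.length + r.length % P.Base A (boolUnpair inp).1.length / P.Kb A (boolUnpair inp).1.length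
        + r.length % P.Base A (boolUnpair inp).1.length % P.Kb A (boolUnpair inp).1.length)
      (boolUnpair inp).2 r).getD []

/-- **The inverter `A'`** with coin budget `cl`. [Goldreich 2001, §2.3.1] [cite: Goldreich2001, Thm. 2.3.2 (proof)] -/
noncomputable def inv (cl : ℕ → ℕ) : RandAlg (List Bool) (List Bool) where
  run := P.run A
  coinLen := cl

/-! #### Deterministic semantics -/

variable {P A}

/-- A kept answer of a trial is a verified `f`-preimage. [Goldreich 2001, §2.3.1 (step 3 of `I`)] [folklore] -/
theorem f_eq_of_trial_eq_some {n m i : ℕ} {y seg v : List Bool} (h : P.trial A n m i y seg = some v) : P.f v = y := by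
  unfold trial at h
  split_ifs at h with hif
  rw [Option.some.injEq] at h
  rw [← h]; exact hif

/-- A hit is a verified `f`-preimage. [folklore] -/
theorem f_eq_of_hits_eq_some {n m c : ℕ} {y r v : List Bool} (h : P.hits A n m c y r = some v) : P.f v = y := by
  unfold hits at h
  obtain ⟨kk, _, hk⟩ := List.exists_of_findSome?_eq_some h
  exact f_eq_of_trial_eq_some hk

/-- No hit iff all trials miss. [folklore] -/
theorem hits_eq_none_iff {n m c : ℕ} {y r : List Bool} :
    P.hits A n m c y r = none ↔ ∀ kk < P.R A n, P.trial A n m (kk % P.T n) y (sgt c kk r) = none := by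
  simp [hits, List.findSome?_eq_none_iff]

/-- `|1ⁿ| = n` — Mathlib's `unary_decode_encode_nat` read through `unaryDecodeNat = List.length`
(private twin of the tree's `length_unaryEncodeNat` lemmas in `LiuPassWeakOWF.lean` /
`FregeProofs.lean`, neither in this file's import closure). [folklore] -/
private theorem length_unaryEncodeNat (n : ℕ) : (unaryEncodeNat n).length = n := unary_decode_encode_nat n

/-- **Decoding the advice.** On `⟨1ⁿ, y⟩` with `|r| = (idx · K_b + κ) + Base · J`, `κ < K_b`,
`idx < M(n+1)`, the run of `A'` is `hits` with `m = M n + idx` and `c = m + κ`. [folklore] -/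
theorem run_boolPair {n idx κ J : ℕ} (hκ : κ < P.Kb A n) (hidx : idx < P.M (n + 1)) (y r : List Bool)
    (hr : r.length = idx * P.Kb A n + κ + P.Base A n * J) :
    P.run A (boolPair (unaryEncodeNat n) y) r = (P.hits A n (P.M n + idx) (P.M n + idx + κ) y r).getD [] := by
  have hadv : r.length % P.Base A n = idx * P.Kb A n + κ := by
    rw [hr, Nat.add_mul_mod_self_left, Nat.mod_eq_of_lt]
    rw [Base_eq]
    calc idx * P.Kb A n + κ < idx * P.Kb A n + P.Kb A n := by omega
      _ = (idx + 1) * P.Kb A n := by ring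
      _ ≤ P.M (n + 1) * P.Kb A n := Nat.mul_le_mul_right _ hidx
  have h1 : (idx * P.Kb A n + κ) / P.Kb A n = idx := by
    rw [Nat.add_comm, Nat.add_mul_div_right _ _ (Kb_pos P A n), Nat.div_eq_of_lt hκ, Nat.zero_add]
  have h2 : (idx * P.Kb A n + κ) % P.Kb A n = κ := by
    rw [Nat.add_comm, Nat.add_mul_mod_self_right, Nat.mod_eq_of_lt hκ]
  simp only [run, boolUnpair_boolPair, length_unaryEncodeNat, hadv, h1, h2]

/-- If some trial hits, `A'` outputs an `f`-preimage. [Goldreich 2001, §2.3.1] [folklore] -/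
theorem f_run_eq {n idx κ J : ℕ} (hκ : κ < P.Kb A n) (hidx : idx < P.M (n + 1)) {y r : List Bool}
    (hr : r.length = idx * P.Kb A n + κ + P.Base A n * J)
    (hh : P.hits A n (P.M n + idx) (P.M n + idx + κ) y r ≠ none) :
    P.f (P.run A (boolPair (unaryEncodeNat n) y) r) = y := by
  rw [run_boolPair hκ hidx y r hr]
  obtain ⟨v, hv⟩ := Option.ne_none_iff_exists'.1 hh
  rw [hv, Option.getD_some]
  exact f_eq_of_hits_eq_some hv

/-- The first coin segment is the prefix. [folklore] -/
theorem sgt_zero {c : ℕ} (r : List Bool) : sgt c 0 r = r.take c := by simp [sgt]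

/-- The next coin segments are those of the tail. [folklore] -/
theorem sgt_succ {c kk : ℕ} (r : List Bool) : sgt c (kk + 1) r = sgt c kk (r.drop c) := by
  simp only [sgt, List.drop_drop]
  congr 2; ring

/-- **Independent trials**: the number of coin strings of length `c·K + e` on which the `K`
trials (position schedule `pos`, consecutive segments of width `c`) all miss is the product of
the per-trial miss counts times `2^e`. [Goldreich 2001, §2.3.1, Claim 2.3.2.1
(`Pr[A' fails] < (1 - n/a(n))^{a(n)}`)] [cite: Goldreich2001, Thm. 2.3.2 (proof)] -/
theorem card_filter_allMiss (n m c : ℕ) (y : List Bool) :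
    ∀ (K e : ℕ) (pos : ℕ → ℕ),
      (univ.filter fun r : List.Vector Bool (c * K + e) =>
          ∀ kk < K, P.trial A n m (pos kk) y (sgt c kk r.toList) = none).card =
        (∏ kk ∈ Finset.range K, (univ.filter fun σ : List.Vector Bool c => P.trial A n m (pos kk) y σ.toList = none).card)
          * 2 ^ e
  | 0, e, pos => by simp [card_vector]
  | K + 1, e, pos => by
    have hlen : c * (K + 1) + e = c + (c * K + e) := by ring
    rw [card_filter_vector_congr hlen (fun r => ∀ kk < K + 1, P.trial A n m (pos kk) y (sgt c kk r) = none)]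
    have h := card_filter_take_drop c (c * K + e) (fun σ => P.trial A n m (pos 0) y σ = none)
      (fun r => ∀ kk < K, P.trial A n m (pos (kk + 1)) y (sgt c kk r) = none)
    rw [card_filter_allMiss n m c y K e (fun kk => pos (kk + 1))] at h
    calc (univ.filter fun r : List.Vector Bool (c + (c * K + e)) => ∀ kk < K + 1, P.trial A n m (pos kk) y (sgt c kk r.toList) = none).card
        = (univ.filter fun r : List.Vector Bool (c + (c * K + e)) => P.trial A n m (pos 0) y (r.toList.take c) = none ∧
            ∀ kk < K, P.trial A n m (pos (kk + 1)) y (sgt c kk (r.toList.drop c)) = none).card := by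
          congr 1; ext r
          simp only [Finset.mem_filter, Finset.mem_univ, true_and]
          constructor
          · intro hr
            refine ⟨by simpa [sgt_zero] using hr 0 (Nat.succ_pos K), fun kk hkk => ?_⟩
            rw [← sgt_succ]; exact hr (kk + 1) (by omega)
          · rintro ⟨h0, hs⟩ kk hkk
            rcases kk with _ | kk
            · simpa [sgt_zero] using h0
            · rw [sgt_succ]; exact hs kk (by omega)
      _ = _ := by rw [h, Finset.prod_range_succ']; ring

end Params

end Inverter

/-! ### The hybrid argument (Goldreich's Claim 2.3.2.2) -/

section Hybrid

open scoped Classical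

namespace Params

variable {P : Params} {A : Adv}

/-- A `RandAlg` probability as a normalised count of coin strings (`Finset` form). Local twin,
scoped to `Yao`, of `RandAlg.pr_eq_card_filter_div` of `LiuPassCondEPPRG.lean` (a file downstream
of S05 in content, hence not imported here; a librarian hoist of both into the `RandAlg` API is
the intended end state). [Arora–Barak 2009, §7.1] [folklore] -/
theorem prCount_eq {α β : Type} (B : RandAlg α β) (ea : α → List Bool) (a : α)
    (E : Set β) [DecidablePred (· ∈ E)] {κ : ℕ} (hκ : B.coinLen (ea a).length = κ) :
    B.pr ea a E = ((univ.filter fun v : List.Vector Bool κ => B.run a v.toList ∈ E).card : ℝ) / 2 ^ κ := by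
  classical
  subst hκ
  unfold RandAlg.pr RandAlg.outputPMF
  rw [PMF.toOuterMeasure_map_apply, PMF.toOuterMeasure_uniformOfFintype_apply, card_vector, Fintype.card_bool,
    ENNReal.toReal_div]
  congr 1
  · norm_cast
    rw [Fintype.card_subtype]
    congr 1
    ext v
    simp
  · simp

variable (P A)

/-- Success of the honest run of `B'` on `g(w)`, `w = σ↾m`, with coins `σ⇂m`. [Goldreich 2001, §2.3.1, eq. (2.7)] [folklore] -/
def Succ (m : ℕ) (σ : List Bool) : Prop :=
  P.g (A.B.run (boolPair (unaryEncodeNat m) (P.g (σ.take m))) (σ.drop m)) = P.g (σ.take m)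

/-- The hit count of position `i` for the instance `x`: coin segments on which the trial at
position `i` with target `f x` finds a preimage (`2^c · Pr[trial hits]`). [Goldreich 2001, §2.3.1
(the probability in the definition of `S_n`)] [cite: Goldreich2001, Thm. 2.3.2 (proof)] -/
noncomputable def cnt (n m c i : ℕ) (x : List Bool) : ℕ :=
  (univ.filter fun σ : List.Vector Bool c => P.trial A n m i (P.f x) σ.toList ≠ none).card

/-- **The good set `S_n`**: instances on which some position hits with probability `≥ θ(n)`.
[Goldreich 2001, §2.3.1 (definition of `S_n`, with `n/a(n) = θ`)] [cite: Goldreich2001, Thm. 2.3.2 (proof)] -/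
def Good (n m c : ℕ) (x : List Bool) : Prop := ∃ i < P.T n, 2 ^ c ≤ P.θinv A n * P.cnt A n m c i x

/-- Standing hypothesis on the parameters `P` (a predicate `Params → Prop` taken as `(hq : P.QPos)`,
not a named fact: it fails e.g. for `q = 0`): the hardness polynomial is positive. The binder is
explicit so that the text census reads it as a parametrised predicate. [folklore] -/
abbrev QPos (P : Params) : Prop := ∀ n, 0 < P.q.eval n

/-- Standing hypothesis on the parameters `P` (a predicate `Params → Prop` taken as `(hp : P.LenBound)`,
not a named fact: it fails e.g. for `f ≡ [true]`, `p = 0`): `p` bounds the output length of `f`,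
`|f x| ≤ p(|x|)`. For a polynomial-time `f` such a `p` exists (`exists_lenBound` below), which is
how `OWFExist_of_weakOWFExist_of` discharges it. The binder is explicit so that the text census
reads it as a parametrised predicate. [Goldreich 2001, §2.2.3.2, before eq. (2.3): "let `p` be a
polynomial bounding the length expansion of `f` (i.e., `|f(x)| ≤ p(|x|)`). Such a polynomial must
exist because `f` is polynomial-time-computable."] [folklore] -/
abbrev LenBound (P : Params) : Prop := ∀ x, (P.f x).length ≤ P.p.eval x.length

variable {P A}

/-- `M n = t(n) · n`. [folklore] -/
theorem M_eq (n : ℕ) : P.M n = P.T n * n := by rw [Params.M, mul_comm]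

/-- A block inside a prefix is a block of the string. [folklore] -/
theorem blk_take {n i m : ℕ} (hm : (i + 1) * n ≤ m) (σ : List Bool) : blk n i (σ.take m) = blk n i σ := by
  rw [Nat.add_mul, one_mul] at hm
  simp only [blk, List.drop_take, List.take_take]
  congr 1; omega

/-- **Invariance of a trial under overwriting block `i` of the sampled input by the instance.**
[Goldreich 2001, §2.3.1] [folklore] -/
theorem trial_ins (hp : P.LenBound) {n i m : ℕ} {x : List Bool} (hx : x.length = n) (hi : i < P.T n) (hn : P.nOf m = n)
    {σ : List Bool} (hσ : m ≤ σ.length) :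
    P.trial A n m i (P.f x) (ins n i x σ) = P.trial A n m i (P.f x) σ := by
  have him : (i + 1) * n ≤ m := by
    have h1 : (i + 1) * n ≤ P.T n * n := Nat.mul_le_mul_right n hi
    have h2 : P.M n ≤ m := by rw [← hn]; exact M_nOf_le P m
    rw [M_eq] at h2; omega
  have hσ' : (i + 1) * n ≤ σ.length := him.trans hσ
  have hlen : (σ.take m).length = m := by simp; omega
  have hn' : P.nOf (σ.take m).length = n := by rw [hlen, hn]
  have hn'' : P.nOf (ins n i x (σ.take m)).length = n := by rw [length_ins hx (by rw [hlen]; exact him), hlen, hn]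
  unfold trial
  rw [take_ins_of_le hx hσ' him, drop_ins_of_le hx hσ' him, ← g_ins hp hx hn'' hi, ins_ins hx (by rw [hlen]; exact him),
    g_ins hp hx hn' hi]

/-- **An honest success of `B'` is a hit of the trial whose instance is the `i`-th block.**
[Goldreich 2001, §2.3.1, eq. (2.8)] [cite: Goldreich2001, Thm. 2.3.2 (proof)] -/
theorem trial_ne_none_of_succ (hq : P.QPos) (hp : P.LenBound) {n i m : ℕ} (hi : i < P.T n) (hn : P.nOf m = n)
    {σ : List Bool} (hσ : m ≤ σ.length) (hs : P.Succ A m σ) : P.trial A n m i (P.f (blk n i σ)) σ ≠ none := by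
  have him : (i + 1) * n ≤ m := by
    have h1 : (i + 1) * n ≤ P.T n * n := Nat.mul_le_mul_right n hi
    have h2 : P.M n ≤ m := by rw [← hn]; exact M_nOf_le P m
    rw [M_eq] at h2; omega
  have hlen : (σ.take m).length = m := by simp; omega
  have hn' : P.nOf (σ.take m).length = n := by rw [hlen, hn]
  have hx : (blk n i (σ.take m)).length = n := length_blk_of_le (by rw [hlen]; exact him)
  rw [← blk_take him σ]
  unfold trial
  rw [← g_ins hp hx hn' hi, ins_blk_self]
  unfold Succ at hs
  rw [if_pos (f_blk_eq_of_g_eq hq hx hn' hi (by rw [ins_blk_self]; exact hs))]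
  exact Option.some_ne_none _

variable {n idx κ : ℕ}

/-- The target lengths `M n + idx < M (n+1)` have block length `n`. [folklore] -/
theorem nOf_m (hq : P.QPos) (hidx : P.M n + idx < P.M (n + 1)) : P.nOf (P.M n + idx) = n :=
  nOf_eq hq (Nat.le_add_right _ _) hidx

/-- The segment width split as blocks + rest. [folklore] -/
theorem c_eq : P.M n + idx + κ = n * P.T n + (idx + κ) := by rw [Params.M]; ring

/-- Blocks of positions `< t(n)` fit inside the target length. [folklore] -/
theorem le_m_of_lt {i : ℕ} (hi : i < P.T n) : (i + 1) * n ≤ P.M n + idx := by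
  have h1 : (i + 1) * n ≤ P.T n * n := Nat.mul_le_mul_right n hi
  rw [M_eq]; omega

/-- **The hybrid bound on the honest success count** (`s(n) = s₁(n) + s₂(n)`):
`#{succ} ≤ Σ_{i<t} Σ_{x ∉ S} #{blk_i = x ∧ hit_i(x)} + #{all blocks in S}`.
[Goldreich 2001, §2.3.1, proof of Claim 2.3.2.2] [cite: Goldreich2001, Thm. 2.3.2 (proof)] -/
theorem card_succ_le (hq : P.QPos) (hp : P.LenBound) (hidx : P.M n + idx < P.M (n + 1)) :
    (univ.filter fun σ : List.Vector Bool (P.M n + idx + κ) => P.Succ A (P.M n + idx) σ.toList).card ≤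
      (∑ i ∈ range (P.T n), ∑ x ∈ univ.filter (fun x : List.Vector Bool n => ¬ P.Good A n (P.M n + idx) (P.M n + idx + κ) x.toList),
          (univ.filter fun σ : List.Vector Bool (P.M n + idx + κ) =>
            blk n i σ.toList = x.toList ∧ P.trial A n (P.M n + idx) i (P.f x.toList) σ.toList ≠ none).card)
        + (univ.filter fun σ : List.Vector Bool (P.M n + idx + κ) =>
            ∀ i < P.T n, P.Good A n (P.M n + idx) (P.M n + idx + κ) (blk n i σ.toList)).card := by
  classical
  set m := P.M n + idx with hm
  set c := m + κ with hc
  set G : List Bool → Prop := P.Good A n m c with hG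
  have hsub : (univ.filter fun σ : List.Vector Bool c => P.Succ A m σ.toList) ⊆
      (Finset.range (P.T n)).biUnion (fun i => univ.filter fun σ : List.Vector Bool c => P.Succ A m σ.toList ∧ ¬ G (blk n i σ.toList))
        ∪ univ.filter (fun σ : List.Vector Bool c => ∀ i < P.T n, G (blk n i σ.toList)) := by
    intro σ hσ
    simp only [Finset.mem_filter, Finset.mem_univ, true_and] at hσ
    simp only [Finset.mem_union, Finset.mem_biUnion, Finset.mem_range, Finset.mem_filter, Finset.mem_univ, true_and]
    by_cases hall : ∀ i < P.T n, G (blk n i σ.toList)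
    · exact Or.inr hall
    · push Not at hall
      obtain ⟨i, hi, hG⟩ := hall
      exact Or.inl ⟨i, hi, hσ, hG⟩
  refine (Finset.card_le_card hsub).trans ((Finset.card_union_le _ _).trans ?_)
  refine Nat.add_le_add_right (Finset.card_biUnion_le.trans (Finset.sum_le_sum fun i hi => ?_)) _
  rw [Finset.mem_range] at hi
  have him : (i + 1) * n ≤ m := le_m_of_lt hi
  have hblen : ∀ σ : List.Vector Bool c, (blk n i σ.toList).length = n := fun σ =>
    length_blk_of_le (him.trans (by rw [List.Vector.toList_length]; omega))
  let fb : List.Vector Bool c → List.Vector Bool n := fun σ => ⟨blk n i σ.toList, hblen σ⟩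
  rw [Finset.card_eq_sum_card_fiberwise (f := fb) (t := univ.filter fun x : List.Vector Bool n => ¬ G x.toList) (by
      intro σ hσ
      exact Finset.mem_filter.2 ⟨Finset.mem_univ _, (Finset.mem_filter.1 hσ).2.2⟩)]
  refine Finset.sum_le_sum fun x _ => Finset.card_le_card fun σ hσ => ?_
  simp only [Finset.mem_filter, Finset.mem_univ, true_and] at hσ ⊢
  obtain ⟨⟨hs, _⟩, hbx⟩ := hσ
  have hbx' : blk n i σ.toList = x.toList := by rw [← hbx]; rfl
  refine ⟨hbx', ?_⟩
  rw [← hbx']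
  exact trial_ne_none_of_succ hq hp hi (nOf_m hq hidx) (by rw [List.Vector.toList_length]; omega) hs

/-- **Outside the good set the hit counts are small**: for `x ∉ S_n` and `i < t(n)`,
`θinv · 2ⁿ · #{blk_i = x ∧ hit_i(x)} < 2^c`. [Goldreich 2001, §2.3.1 (definition of `S_n` and eq. (2.8))]
[cite: Goldreich2001, Thm. 2.3.2 (proof)] -/
theorem small_of_not_good (hq : P.QPos) (hp : P.LenBound) (hidx : P.M n + idx < P.M (n + 1))
    {x : List.Vector Bool n} (hx : ¬ P.Good A n (P.M n + idx) (P.M n + idx + κ) x.toList)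
    {i : ℕ} (hi : i < P.T n) :
    P.θinv A n * (2 ^ n * (univ.filter fun σ : List.Vector Bool (P.M n + idx + κ) =>
        blk n i σ.toList = x.toList ∧ P.trial A n (P.M n + idx) i (P.f x.toList) σ.toList ≠ none).card)
      < 2 ^ (P.M n + idx + κ) := by
  classical
  have him : (i + 1) * n ≤ P.M n + idx := le_m_of_lt hi
  rw [two_pow_mul_card_filter_blk_eq x.toList_length (him.trans (Nat.le_add_right _ _))
    (fun σ => P.trial A n (P.M n + idx) i (P.f x.toList) σ ≠ none)
    (fun σ => by rw [trial_ins hp x.toList_length hi (nOf_m hq hidx) (by rw [List.Vector.toList_length]; omega)])]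
  simp only [Good, not_exists, not_and, not_le] at hx
  exact hx i hi

/-- **Claim 2.3.2.2 in count form**: the honest success count is at most
`t · 2ⁿ⁺ᶜ/(2ⁿ θinv)`-ish plus `|S|^t 2^{c - nt}`; precisely, in `ℝ`:
`#{succ}/2^c ≤ t(n)/θinv(n) + (|S_n|/2ⁿ)^{t(n)}`. [Goldreich 2001, §2.3.1, Claim 2.3.2.2]
[cite: Goldreich2001, Thm. 2.3.2 (proof)] -/
theorem card_succ_div_le (hq : P.QPos) (hp : P.LenBound) (hidx : P.M n + idx < P.M (n + 1)) (hn : 0 < n) :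
    ((univ.filter fun σ : List.Vector Bool (P.M n + idx + κ) => P.Succ A (P.M n + idx) σ.toList).card : ℝ)
        / 2 ^ (P.M n + idx + κ) ≤
      (P.T n : ℝ) / P.θinv A n +
        (((univ.filter fun x : List.Vector Bool n => P.Good A n (P.M n + idx) (P.M n + idx + κ) x.toList).card : ℝ) / 2 ^ n)
          ^ P.T n := by
  classical
  set m := P.M n + idx with hm
  set c := m + κ with hc
  have hθ : 0 < P.θinv A n := by
    unfold θinv
    have := T_pos hq hn
    have : 0 < P.M (n + 1) := lt_of_le_of_lt (Nat.zero_le _) hidx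
    positivity
  have hθr : (0 : ℝ) < P.θinv A n := by exact_mod_cast hθ
  have h2c : (0 : ℝ) < 2 ^ c := by positivity
  have hmain := card_succ_le (A := A) (κ := κ) hq hp hidx
  -- first term
  have hterm : ∀ i ∈ Finset.range (P.T n), ∀ x ∈ univ.filter (fun x : List.Vector Bool n => ¬ P.Good A n m c x.toList),
      ((univ.filter fun σ : List.Vector Bool c => blk n i σ.toList = x.toList ∧ P.trial A n m i (P.f x.toList) σ.toList ≠ none).card : ℝ)
        ≤ 2 ^ c / (2 ^ n * P.θinv A n) := by
    intro i hi x hx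
    rw [Finset.mem_range] at hi
    simp only [Finset.mem_filter, Finset.mem_univ, true_and] at hx
    have h := small_of_not_good (A := A) hq hp hidx hx hi
    rw [le_div_iff₀ (by positivity)]
    have h' : (P.θinv A n : ℝ) * (2 ^ n * ((univ.filter fun σ : List.Vector Bool c =>
        blk n i σ.toList = x.toList ∧ P.trial A n m i (P.f x.toList) σ.toList ≠ none).card : ℝ)) < 2 ^ c := by
      exact_mod_cast h
    nlinarith [h']
  have hsum : ((∑ i ∈ range (P.T n), ∑ x ∈ univ.filter (fun x : List.Vector Bool n => ¬ P.Good A n m c x.toList),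
      (univ.filter fun σ : List.Vector Bool c => blk n i σ.toList = x.toList ∧ P.trial A n m i (P.f x.toList) σ.toList ≠ none).card : ℕ) : ℝ)
        ≤ P.T n * (2 ^ n * (2 ^ c / (2 ^ n * P.θinv A n))) := by
    push_cast
    calc _ ≤ ∑ i ∈ range (P.T n), ∑ x ∈ univ.filter (fun x : List.Vector Bool n => ¬ P.Good A n m c x.toList),
          (2 : ℝ) ^ c / (2 ^ n * P.θinv A n) := Finset.sum_le_sum fun i hi => Finset.sum_le_sum fun x hx => hterm i hi x hx
      _ = ∑ i ∈ range (P.T n), ((univ.filter (fun x : List.Vector Bool n => ¬ P.Good A n m c x.toList)).card : ℝ) *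
          (2 ^ c / (2 ^ n * P.θinv A n)) := by simp [Finset.sum_const, nsmul_eq_mul]
      _ ≤ ∑ i ∈ range (P.T n), (2 : ℝ) ^ n * (2 ^ c / (2 ^ n * P.θinv A n)) := by
          refine Finset.sum_le_sum fun i _ => mul_le_mul_of_nonneg_right ?_ (by positivity)
          have := Finset.card_filter_le (univ : Finset (List.Vector Bool n)) (fun x => ¬ P.Good A n m c x.toList)
          rw [Finset.card_univ, card_vector, Fintype.card_bool] at this
          exact_mod_cast this
      _ = _ := by simp [Finset.sum_const, nsmul_eq_mul]
  -- second term
  have hall : (univ.filter fun σ : List.Vector Bool c => ∀ i < P.T n, P.Good A n m c (blk n i σ.toList)).card =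
      (univ.filter fun x : List.Vector Bool n => P.Good A n m c x.toList).card ^ P.T n * 2 ^ (idx + κ) := by
    rw [← card_filter_forall_blk n (P.Good A n m c) (P.T n) (idx + κ)]
    exact card_filter_vector_congr c_eq (fun w => ∀ i < P.T n, P.Good A n m c (blk n i w))
  have hc2 : (2 : ℝ) ^ c = (2 ^ n) ^ P.T n * 2 ^ (idx + κ) := by
    rw [hc, hm, c_eq, pow_add, pow_mul]
  rw [div_le_iff₀ h2c]
  have hmain' : ((univ.filter fun σ : List.Vector Bool c => P.Succ A m σ.toList).card : ℝ) ≤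
      P.T n * (2 ^ n * (2 ^ c / (2 ^ n * P.θinv A n))) +
        ((univ.filter fun x : List.Vector Bool n => P.Good A n m c x.toList).card : ℝ) ^ P.T n * 2 ^ (idx + κ) := by
    have h0 := hmain
    rw [hall] at h0
    have h1 : ((univ.filter fun σ : List.Vector Bool c => P.Succ A m σ.toList).card : ℝ) ≤
        ((∑ i ∈ range (P.T n), ∑ x ∈ univ.filter (fun x : List.Vector Bool n => ¬ P.Good A n m c x.toList),
          (univ.filter fun σ : List.Vector Bool c => blk n i σ.toList = x.toList ∧ P.trial A n m i (P.f x.toList) σ.toList ≠ none).card : ℕ) : ℝ)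
          + (((univ.filter fun x : List.Vector Bool n => P.Good A n m c x.toList).card ^ P.T n * 2 ^ (idx + κ) : ℕ) : ℝ) := by
      exact_mod_cast h0
    push_cast at h1 hsum ⊢
    linarith [hsum]
  have h2n : (2 : ℝ) ^ n ≠ 0 := by positivity
  have heq : ((P.T n : ℝ) / P.θinv A n +
        (((univ.filter fun x : List.Vector Bool n => P.Good A n m c x.toList).card : ℝ) / 2 ^ n) ^ P.T n) * 2 ^ c =
      P.T n * (2 ^ n * (2 ^ c / (2 ^ n * P.θinv A n))) +
        ((univ.filter fun x : List.Vector Bool n => P.Good A n m c x.toList).card : ℝ) ^ P.T n * 2 ^ (idx + κ) := by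
    rw [add_mul, div_pow]
    congr 1
    · field_simp
    · rw [hc2]
      field_simp
  rw [heq]
  exact hmain'

/-- The queries of `B'` all have length `QL n idx`. [folklore] -/
theorem length_query (hq : P.QPos) (hp : P.LenBound) (hidx : P.M n + idx < P.M (n + 1)) (w : List.Vector Bool (P.M n + idx)) :
    (boolPair (unaryEncodeNat (P.M n + idx)) (P.g w.toList)).length = P.QL n idx := by
  rw [length_boolPair, length_unaryEncodeNat, length_g hp, w.toList_length, nOf_m hq hidx, QL, Params.M]
  simp

/-- **`Pr[B' inverts g on U_m]` as the normalised honest success count over `{0,1}^{m+κ}`**,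
`κ = B'`'s coin count on these (equal-length) queries. [Goldreich 2001, §2.3.1, eq. (2.7)] [folklore] -/
theorem invertProb_g_eq (hq : P.QPos) (hp : P.LenBound) (hidx : P.M n + idx < P.M (n + 1)) (hκ : A.B.coinLen (P.QL n idx) = κ) :
    invertProb P.g A.B (P.M n + idx) =
      ((univ.filter fun σ : List.Vector Bool (P.M n + idx + κ) => P.Succ A (P.M n + idx) σ.toList).card : ℝ)
        / 2 ^ (P.M n + idx + κ) := by
  classical
  unfold invertProb uniformAvg
  have hpr : ∀ w : List.Vector Bool (P.M n + idx),
      A.B.pr id (boolPair (unaryEncodeNat (P.M n + idx)) (P.g w.toList)) {z | P.g z = P.g w.toList} =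
        ((univ.filter fun v : List.Vector Bool κ =>
            P.g (A.B.run (boolPair (unaryEncodeNat (P.M n + idx)) (P.g w.toList)) v.toList) = P.g w.toList).card : ℝ) / 2 ^ κ := by
    intro w
    rw [prCount_eq A.B id _ {z | P.g z = P.g w.toList} (by rw [id, length_query hq hp hidx, hκ])]
    rfl
  simp only [hpr, ← Finset.sum_div]
  rw [div_div, ← pow_add, add_comm κ]
  congr 1
  have h := congrArg (Nat.cast : ℕ → ℝ) (sum_card_filter_eq_card (P.M n + idx) κ
    (fun u v => P.g (A.B.run (boolPair (unaryEncodeNat (P.M n + idx)) (P.g u)) v) = P.g u))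
  push_cast at h
  unfold Succ
  convert h using 4

/-- **Claim 2.3.2.2** (probability form): if `B'`'s coin count on its queries is `κ`, then
`Pr[B' inverts g on U_m] ≤ t(n)/θinv(n) + (|S_n|/2ⁿ)^{t(n)}`, `m = M n + idx`.
[Goldreich 2001, §2.3.1, Claim 2.3.2.2] [cite: Goldreich2001, Thm. 2.3.2 (proof)] -/
theorem invertProb_g_le (hq : P.QPos) (hp : P.LenBound) (hidx : P.M n + idx < P.M (n + 1)) (hn : 0 < n)
    (hκ : A.B.coinLen (P.QL n idx) = κ) :
    invertProb P.g A.B (P.M n + idx) ≤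
      (P.T n : ℝ) / P.θinv A n +
        (((univ.filter fun x : List.Vector Bool n => P.Good A n (P.M n + idx) (P.M n + idx + κ) x.toList).card : ℝ) / 2 ^ n)
          ^ P.T n := by
  rw [invertProb_g_eq hq hp hidx hκ]
  exact card_succ_div_le hq hp hidx hn

end Params

end Hybrid

/-! ### The success probability of `A'` (Goldreich's Claim 2.3.2.1) -/

section ASide

open scoped Classical

namespace Params

variable {P : Params} {A : Adv} {n idx κ : ℕ}

/-- The segment width is below the modulus: `M n + idx + κ < Base n`. [folklore] -/
theorem c_lt_Base (hκ : κ < P.Kb A n) (hidx : P.M n + idx < P.M (n + 1)) : P.M n + idx + κ < P.Base A n := by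
  rw [Base_eq]
  calc P.M n + idx + κ < (P.M n + idx + 1) * (κ + 1) := by nlinarith
    _ ≤ P.M (n + 1) * P.Kb A n := Nat.mul_le_mul hidx hκ

/-- The miss count of position `i` for the instance `x`. [folklore] -/
noncomputable def miss (P : Params) (A : Adv) (n m c i : ℕ) (x : List Bool) : ℕ :=
  (univ.filter fun σ : List.Vector Bool c => P.trial A n m i (P.f x) σ.toList = none).card

/-- Misses and hits partition the coin segments. [folklore] -/
theorem miss_add_cnt (n m c i : ℕ) (x : List Bool) : P.miss A n m c i x + P.cnt A n m c i x = 2 ^ c := by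
  unfold miss cnt
  rw [Finset.card_filter_add_card_filter_not, Finset.card_univ, card_vector, Fintype.card_bool]

/-- **All trials miss**: count of the coin strings of `A'` on which no trial hits.
[Goldreich 2001, §2.3.1, Claim 2.3.2.1] [cite: Goldreich2001, Thm. 2.3.2 (proof)] -/
theorem card_hits_none (hκ : κ < P.Kb A n) (hidx : P.M n + idx < P.M (n + 1)) (y : List Bool) {L : ℕ}
    (hL : L = idx * P.Kb A n + κ + P.Base A n * P.R A n) :
    (univ.filter fun r : List.Vector Bool L => P.hits A n (P.M n + idx) (P.M n + idx + κ) y r.toList = none).card =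
      (∏ kk ∈ Finset.range (P.R A n), (univ.filter fun σ : List.Vector Bool (P.M n + idx + κ) =>
          P.trial A n (P.M n + idx) (kk % P.T n) y σ.toList = none).card)
        * 2 ^ (L - (P.M n + idx + κ) * P.R A n) := by
  have hcB := c_lt_Base hκ hidx
  have hcR : (P.M n + idx + κ) * P.R A n ≤ L := by
    rw [hL]
    exact (Nat.mul_le_mul_right _ hcB.le).trans (Nat.le_add_left _ _)
  rw [card_filter_vector_congr (show L = (P.M n + idx + κ) * P.R A n + (L - (P.M n + idx + κ) * P.R A n) by omega)
    (fun r => P.hits A n (P.M n + idx) (P.M n + idx + κ) y r = none)]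
  simp only [hits_eq_none_iff]
  exact card_filter_allMiss n (P.M n + idx) (P.M n + idx + κ) y (P.R A n) _ (fun kk => kk % P.T n)

/-- A product over `T·a` indices of a `T`-periodic sequence is an `a`-th power. [folklore] -/
theorem prod_range_mul_mod (T a : ℕ) (u : ℕ → ℝ) : ∏ kk ∈ Finset.range (T * a), u (kk % T) = (∏ i ∈ Finset.range T, u i) ^ a := by
  induction a with
  | zero => simp
  | succ a ih =>
    rw [Nat.mul_succ, Finset.prod_range_add, ih, pow_succ]
    congr 1
    refine Finset.prod_congr rfl fun i hi => ?_
    rw [Finset.mem_range] at hi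
    rw [Nat.add_comm, Nat.add_mul_mod_self_left, Nat.mod_eq_of_lt hi]

/-- A product of factors in `[0,1]` is at most any single factor. [folklore] -/
theorem prod_range_le_single {T : ℕ} {u : ℕ → ℝ} (h0 : ∀ i, 0 ≤ u i) (h1 : ∀ i, u i ≤ 1) {i₀ : ℕ} (hi₀ : i₀ < T) :
    ∏ i ∈ Finset.range T, u i ≤ u i₀ := by
  rw [← Finset.mul_prod_erase _ _ (Finset.mem_range.2 hi₀)]
  exact mul_le_of_le_one_right (h0 _) (Finset.prod_le_one (fun i _ => h0 i) fun i _ => h1 i)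

/-- **Claim 2.3.2.1**: the inverter's success probability on `⟨1ⁿ, f x⟩` is at least
`1 - ∏_{kk} (1 - P_{kk mod t}(x))`, the trials being independent and every hit a verified
preimage. [Goldreich 2001, §2.3.1, Claim 2.3.2.1] [cite: Goldreich2001, Thm. 2.3.2 (proof)] -/
theorem pr_inv_ge (hκ : κ < P.Kb A n) (hidx : P.M n + idx < P.M (n + 1)) {cl : ℕ → ℕ} (x : List Bool)
    (hcl : cl (boolPair (unaryEncodeNat n) (P.f x)).length = idx * P.Kb A n + κ + P.Base A n * P.R A n) :
    1 - ∏ kk ∈ Finset.range (P.R A n), ((P.miss A n (P.M n + idx) (P.M n + idx + κ) (kk % P.T n) x : ℝ) / 2 ^ (P.M n + idx + κ))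
      ≤ (P.inv A cl).pr id (boolPair (unaryEncodeNat n) (P.f x)) {z | P.f z = P.f x} := by
  set L := idx * P.Kb A n + κ + P.Base A n * P.R A n with hL
  set m := P.M n + idx with hm
  set c := m + κ with hc
  have hcB : c < P.Base A n := c_lt_Base hκ hidx
  have hcR : c * P.R A n ≤ L := (Nat.mul_le_mul_right _ hcB.le).trans (Nat.le_add_left _ _)
  rw [prCount_eq (P.inv A cl) id _ {z | P.f z = P.f x} (κ := L) (by simpa [inv] using hcl)]
  have hsub : (univ.filter fun r : List.Vector Bool L => P.hits A n m c (P.f x) r.toList ≠ none) ⊆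
      univ.filter fun r : List.Vector Bool L => (P.inv A cl).run (boolPair (unaryEncodeNat n) (P.f x)) r.toList ∈ {z | P.f z = P.f x} := by
    intro r hr
    simp only [Finset.mem_filter, Finset.mem_univ, true_and, Set.mem_setOf_eq] at hr ⊢
    exact f_run_eq hκ (by omega) (J := P.R A n) (by rw [r.toList_length]) hr
  have hcard := Finset.card_le_card hsub
  have hcompl : (univ.filter fun r : List.Vector Bool L => P.hits A n m c (P.f x) r.toList ≠ none).card +
      (univ.filter fun r : List.Vector Bool L => P.hits A n m c (P.f x) r.toList = none).card = 2 ^ L := by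
    have h := Finset.card_filter_add_card_filter_not (s := (univ : Finset (List.Vector Bool L)))
      (fun r : List.Vector Bool L => P.hits A n m c (P.f x) r.toList ≠ none)
    simp only [not_not, Finset.card_univ, card_vector, Fintype.card_bool] at h
    exact h
  have hnone := card_hits_none hκ hidx (P.f x) hL
  rw [le_div_iff₀ (by positivity), sub_mul, one_mul]
  have h2L : (2 : ℝ) ^ L = (2 ^ c) ^ P.R A n * 2 ^ (L - c * P.R A n) := by
    rw [← pow_mul, ← pow_add]; congr 1; omega
  have hprod : (∏ kk ∈ Finset.range (P.R A n), ((P.miss A n m c (kk % P.T n) x : ℝ) / 2 ^ c)) * 2 ^ L =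
      ((∏ kk ∈ Finset.range (P.R A n), (univ.filter fun σ : List.Vector Bool c =>
          P.trial A n m (kk % P.T n) (P.f x) σ.toList = none).card) * 2 ^ (L - c * P.R A n) : ℕ) := by
    rw [Finset.prod_div_distrib, Finset.prod_const, Finset.card_range, h2L]
    push_cast
    unfold miss
    field_simp
  rw [hprod, ← hnone]
  have h1 : ((univ.filter fun r : List.Vector Bool L => P.hits A n m c (P.f x) r.toList ≠ none).card : ℝ) ≤
      (univ.filter fun r : List.Vector Bool L => (P.inv A cl).run (boolPair (unaryEncodeNat n) (P.f x)) r.toList ∈ {z | P.f z = P.f x}).card := by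
    exact_mod_cast hcard
  have h2 : ((univ.filter fun r : List.Vector Bool L => P.hits A n m c (P.f x) r.toList ≠ none).card : ℝ) +
      (univ.filter fun r : List.Vector Bool L => P.hits A n m c (P.f x) r.toList = none).card = 2 ^ L := by
    exact_mod_cast hcompl
  linarith

/-- **Claim 2.3.2.1 for good instances**: for `x ∈ S_n`, `Pr[A' inverts f on f x] ≥ 1 - (1 - θ)^{a(n)}`.
[Goldreich 2001, §2.3.1, Claim 2.3.2.1] [cite: Goldreich2001, Thm. 2.3.2 (proof)] -/
theorem pr_inv_ge_of_good (hκ : κ < P.Kb A n) (hidx : P.M n + idx < P.M (n + 1)) (hn : 0 < n) (hq : P.QPos)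
    {cl : ℕ → ℕ} {x : List Bool} (hgood : P.Good A n (P.M n + idx) (P.M n + idx + κ) x)
    (hcl : cl (boolPair (unaryEncodeNat n) (P.f x)).length = idx * P.Kb A n + κ + P.Base A n * P.R A n) :
    1 - (1 - 1 / (P.θinv A n : ℝ)) ^ P.reps A n ≤ (P.inv A cl).pr id (boolPair (unaryEncodeNat n) (P.f x)) {z | P.f z = P.f x} := by
  refine le_trans ?_ (pr_inv_ge hκ hidx x hcl)
  set m := P.M n + idx
  set c := m + κ
  have h2c : (0 : ℝ) < 2 ^ c := by positivity
  set u : ℕ → ℝ := fun i => (P.miss A n m c i x : ℝ) / 2 ^ c with hu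
  have hu0 : ∀ i, 0 ≤ u i := fun i => by positivity
  have hu1 : ∀ i, u i ≤ 1 := fun i => by
    rw [hu, div_le_one h2c]
    have := miss_add_cnt (P := P) (A := A) n m c i x
    exact_mod_cast (Nat.le_add_right _ _).trans_eq this
  obtain ⟨i₀, hi₀, hgi⟩ := hgood
  have hθ : (0 : ℝ) < P.θinv A n := by
    have : 0 < P.θinv A n := by
      unfold θinv
      have := T_pos hq hn
      have : 0 < P.M (n + 1) := lt_of_le_of_lt (Nat.zero_le _) hidx
      positivity
    exact_mod_cast this
  have hui₀ : u i₀ ≤ 1 - 1 / (P.θinv A n : ℝ) := by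
    rw [hu]
    simp only
    have hmc := miss_add_cnt (P := P) (A := A) n m c i₀ x
    have hmc' : (P.miss A n m c i₀ x : ℝ) = 2 ^ c - P.cnt A n m c i₀ x := by
      have : ((P.miss A n m c i₀ x + P.cnt A n m c i₀ x : ℕ) : ℝ) = (2 : ℝ) ^ c := by exact_mod_cast hmc
      push_cast at this; linarith
    have hgi' : (2 : ℝ) ^ c ≤ P.θinv A n * P.cnt A n m c i₀ x := by exact_mod_cast hgi
    rw [hmc', sub_div, div_self h2c.ne', sub_le_sub_iff_left, div_le_div_iff₀ hθ h2c, one_mul]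
    linarith
  show 1 - (1 - 1 / (P.θinv A n : ℝ)) ^ P.reps A n ≤ 1 - ∏ kk ∈ Finset.range (P.R A n), u (kk % P.T n)
  rw [sub_le_sub_iff_left, Params.R, prod_range_mul_mod]
  exact pow_le_pow_left₀ (Finset.prod_nonneg fun i _ => hu0 i) ((prod_range_le_single hu0 hu1 hi₀).trans hui₀) _

/-- **Combining the claims**: `Pr[A' inverts f on U_n] ≥ (|S_n|/2ⁿ) · (1 - (1-θ)^{a(n)})`, provided
the coin budget of `A'` on all inputs `⟨1ⁿ, f x⟩`, `|x| = n`, carries the advice `(idx, κ)`.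
[Goldreich 2001, §2.3.1 (last display of the proof)] [cite: Goldreich2001, Thm. 2.3.2 (proof)] -/
theorem invertProb_f_ge (hκ : κ < P.Kb A n) (hidx : P.M n + idx < P.M (n + 1)) (hn : 0 < n) (hq : P.QPos)
    {cl : ℕ → ℕ}
    (hcl : ∀ x : List.Vector Bool n, cl (boolPair (unaryEncodeNat n) (P.f x.toList)).length = idx * P.Kb A n + κ + P.Base A n * P.R A n) :
    ((univ.filter fun x : List.Vector Bool n => P.Good A n (P.M n + idx) (P.M n + idx + κ) x.toList).card : ℝ) / 2 ^ n *
        (1 - (1 - 1 / (P.θinv A n : ℝ)) ^ P.reps A n)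
      ≤ invertProb P.f (P.inv A cl) n := by
  unfold invertProb uniformAvg
  rw [div_mul_eq_mul_div, div_le_div_iff_of_pos_right (by positivity)]
  set ρ : ℝ := (1 - 1 / (P.θinv A n : ℝ)) ^ P.reps A n
  calc ((univ.filter fun x : List.Vector Bool n => P.Good A n (P.M n + idx) (P.M n + idx + κ) x.toList).card : ℝ) * (1 - ρ)
      = ∑ x : List.Vector Bool n, (if P.Good A n (P.M n + idx) (P.M n + idx + κ) x.toList then (1 - ρ) else 0) := by
        rw [← Finset.sum_filter, Finset.sum_const, nsmul_eq_mul]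
    _ ≤ _ := Finset.sum_le_sum fun x _ => by
        split_ifs with hg
        · exact pr_inv_ge_of_good hκ hidx hn hq hg (hcl x)
        · exact (P.inv A cl).pr_nonneg _ _ _

end Params

end ASide

/-! ### Analysis: the amplification bounds -/

section Analysis

/-- `(1 - 1/N)^{nN} ≤ e⁻ⁿ`. [Goldreich 2001, §2.3.1, Claim 2.3.2.1 (`(1 - n/a(n))^{a(n)} < 2⁻ⁿ`)] [folklore] -/
theorem one_sub_div_pow_mul_le {N n : ℕ} (hN : 1 ≤ N) : (1 - 1 / (N : ℝ)) ^ (n * N) ≤ Real.exp (-(n : ℝ)) := by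
  have hN' : (1 : ℝ) ≤ N := by exact_mod_cast hN
  have h1 : (1 - 1 / (N : ℝ)) ^ N ≤ Real.exp (-1) := Real.one_sub_div_pow_le_exp_neg (n := N) (t := 1) hN'
  have h0 : 0 ≤ 1 - 1 / (N : ℝ) := by
    rw [sub_nonneg, div_le_one (by linarith)]; exact hN'
  rw [pow_mul']
  calc ((1 - 1 / (N : ℝ)) ^ N) ^ n ≤ (Real.exp (-1)) ^ n := pow_le_pow_left₀ (pow_nonneg h0 _) h1 n
    _ = Real.exp (-(n : ℝ)) := by rw [← Real.exp_nat_mul]; ring_nf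

/-- `(1 - 1/(2Q))^{nQ} ≤ e^{-n/2}`. [Goldreich 2001, §2.3.1 (`(1 - 1/2p(n))^{np(n)} < 2^{-n/2}`)] [folklore] -/
theorem one_sub_half_div_pow_mul_le {Q n : ℕ} (hQ : 1 ≤ Q) :
    (1 - 1 / (2 * (Q : ℝ))) ^ (n * Q) ≤ Real.exp (-(n : ℝ) / 2) := by
  have hQ' : (1 : ℝ) ≤ Q := by exact_mod_cast hQ
  have h1 : (1 - 1 / (2 * (Q : ℝ))) ^ Q ≤ Real.exp (-(1 / 2)) := by
    have h := Real.one_sub_div_pow_le_exp_neg (n := Q) (t := 1 / 2) (by linarith)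
    have heq : 1 - 1 / (2 * (Q : ℝ)) = 1 - 1 / 2 / Q := by field_simp
    rw [heq]; exact h
  have h0 : 0 ≤ 1 - 1 / (2 * (Q : ℝ)) := by
    rw [sub_nonneg, div_le_one (by linarith)]; linarith
  rw [pow_mul']
  calc ((1 - 1 / (2 * (Q : ℝ))) ^ Q) ^ n ≤ (Real.exp (-(1 / 2))) ^ n := pow_le_pow_left₀ (pow_nonneg h0 _) h1 n
    _ = Real.exp (-(n : ℝ) / 2) := by rw [← Real.exp_nat_mul]; ring_nf

/-- `Q(n) ≤ Q(1) · n^{deg Q}` for `n ≥ 1` (private twin of `Literature.Computability.Complexity.natPoly_eval_le_eval_one_mul_pow`,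
`CircuitLowerBounds.lean`, not in this file's import closure). [folklore] -/
private theorem natPoly_eval_le_mul_pow (Q : Polynomial ℕ) {n : ℕ} (hn : 1 ≤ n) : Q.eval n ≤ Q.eval 1 * n ^ Q.natDegree := by
  rw [Polynomial.eval_eq_sum_range, Polynomial.eval_eq_sum_range, Finset.sum_mul]
  refine Finset.sum_le_sum fun i hi => ?_
  rw [one_pow, mul_one]
  rw [Finset.mem_range] at hi
  exact Nat.mul_le_mul_left _ (Nat.pow_le_pow_right hn (by omega))

/-- **Polynomials lose against exponentials**: `Q(n) · e^{-cn} < 1` eventually. [folklore] -/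
theorem eventually_natPoly_mul_exp_lt (Q : Polynomial ℕ) {c : ℝ} (hc : 0 < c) :
    ∀ᶠ n : ℕ in atTop, ((Q.eval n : ℕ) : ℝ) * Real.exp (-(c * n)) < 1 := by
  set d := Q.natDegree
  have h1 : Tendsto (fun n : ℕ => (n : ℝ) ^ d * Real.exp (-(c * n))) atTop (nhds 0) := by
    have h := (Real.tendsto_pow_mul_exp_neg_atTop_nhds_zero d).comp
      ((tendsto_natCast_atTop_atTop (R := ℝ)).const_mul_atTop hc)
    have h' := h.const_mul ((c⁻¹) ^ d)
    rw [mul_zero] at h'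
    refine h'.congr fun n => ?_
    show c⁻¹ ^ d * ((c * (n : ℝ)) ^ d * Real.exp (-(c * n))) = (n : ℝ) ^ d * Real.exp (-(c * n))
    rw [mul_pow, ← mul_assoc, ← mul_assoc, ← mul_pow, inv_mul_cancel₀ hc.ne', one_pow, one_mul]
  have h2 := h1.const_mul ((Q.eval 1 : ℕ) : ℝ)
  rw [mul_zero] at h2
  have h3 : ∀ᶠ n : ℕ in atTop, ((Q.eval 1 : ℕ) : ℝ) * ((n : ℝ) ^ d * Real.exp (-(c * n))) < 1 :=
    h2.eventually (gt_mem_nhds one_pos)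
  filter_upwards [h3, eventually_ge_atTop 1] with n hn hn1
  calc ((Q.eval n : ℕ) : ℝ) * Real.exp (-(c * n)) ≤ ((Q.eval 1 : ℕ) : ℝ) * ((n : ℝ) ^ d * Real.exp (-(c * n))) := by
        rw [← mul_assoc]
        refine mul_le_mul_of_nonneg_right ?_ (Real.exp_nonneg _)
        exact_mod_cast natPoly_eval_le_mul_pow Q hn1
    _ < 1 := hn

/-- A nonnegative sequence that is not negligible is at least `1/n^k` infinitely often — the
contrapositive reading of the family's `isNegligible_iff_eventually_lt_of_nonneg`
(`Pseudorandomness.lean`; cf. `Literature.Computability.Cryptography.exists_infinite_ge_inv_pow_of_not_superpolynomialDecay`,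
`LatticeOWF.lean`, the `Set.Infinite` form). [Goldreich 2001, §1.3.5] [cite: Goldreich2001, Def. 1.3.5] -/
private theorem exists_frequently_ge_of_not_superpolynomialDecay {u : ℕ → ℝ} (h0 : ∀ n, 0 ≤ u n)
    (h : ¬ SuperpolynomialDecay atTop (fun n : ℕ => (n : ℝ)) u) :
    ∃ k : ℕ, ∃ᶠ n : ℕ in atTop, 1 / (n : ℝ) ^ k ≤ u n := by
  have h' := (isNegligible_iff_eventually_lt_of_nonneg h0).not.1 h
  push Not at h'
  obtain ⟨c, hc⟩ := h'
  exact ⟨c, by simpa [Filter.not_eventually, not_lt] using hc⟩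

namespace Params

open scoped Classical

variable {P : Params} {A : Adv} {n idx κ : ℕ}

/-- **Claim 2.3.2.2 concluded**: if `B'` inverts `g` on `U_m` with probability `≥ 1/m^k`
(`m = M n + idx`) and `n` is large, then `|S_n| ≥ (1 - 1/(2q(n))) · 2ⁿ`.
[Goldreich 2001, §2.3.1, Claim 2.3.2.2] [cite: Goldreich2001, Thm. 2.3.2 (proof)] -/
theorem density_good_ge (hq : P.QPos) (hp : P.LenBound) (hidx : P.M n + idx < P.M (n + 1)) (hn : 0 < n)
    (hκ : A.B.coinLen (P.QL n idx) = κ)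
    (hGOOD : 1 / ((P.M n + idx : ℕ) : ℝ) ^ A.k ≤ invertProb P.g A.B (P.M n + idx))
    (hE1 : 2 * ((P.M (n + 1) : ℕ) : ℝ) ^ A.k * Real.exp (-(n : ℝ) / 2) < 1) :
    1 - 1 / (2 * ((P.q.eval n : ℕ) : ℝ)) ≤
      ((univ.filter fun x : List.Vector Bool n => P.Good A n (P.M n + idx) (P.M n + idx + κ) x.toList).card : ℝ) / 2 ^ n := by
  by_contra hlt
  push Not at hlt
  have hle := invertProb_g_le hq hp hidx hn hκ
  set s := ((univ.filter fun x : List.Vector Bool n => P.Good A n (P.M n + idx) (P.M n + idx + κ) x.toList).card : ℝ) / 2 ^ n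
  have hs0 : 0 ≤ s := by positivity
  have hT0 : (0 : ℝ) < P.T n := by exact_mod_cast T_pos hq hn
  have hM1 : (0 : ℝ) < (P.M (n + 1) : ℕ) := by exact_mod_cast (lt_of_le_of_lt (Nat.zero_le _) hidx)
  have hT : (P.T n : ℝ) / P.θinv A n = 1 / (2 * ((P.M (n + 1) : ℕ) : ℝ) ^ A.k) := by
    unfold θinv; push_cast; field_simp
  have hq1 : 1 ≤ P.q.eval n := hq n
  have hpow : s ^ P.T n ≤ Real.exp (-(n : ℝ) / 2) := by
    calc s ^ P.T n ≤ (1 - 1 / (2 * ((P.q.eval n : ℕ) : ℝ))) ^ P.T n := pow_le_pow_left₀ hs0 hlt.le _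
      _ ≤ Real.exp (-(n : ℝ) / 2) := one_sub_half_div_pow_mul_le hq1
  have hm0 : (0 : ℝ) < (P.M n + idx : ℕ) := by
    have := le_M hq n
    exact_mod_cast (show 0 < P.M n + idx by omega)
  have hmM : ((P.M n + idx : ℕ) : ℝ) ^ A.k ≤ ((P.M (n + 1) : ℕ) : ℝ) ^ A.k :=
    pow_le_pow_left₀ hm0.le (by exact_mod_cast hidx.le) _
  have h1 : 1 / ((P.M (n + 1) : ℕ) : ℝ) ^ A.k ≤ 1 / ((P.M n + idx : ℕ) : ℝ) ^ A.k :=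
    one_div_le_one_div_of_le (pow_pos hm0 _) hmM
  have hE1' : Real.exp (-(n : ℝ) / 2) < 1 / (2 * ((P.M (n + 1) : ℕ) : ℝ) ^ A.k) := by
    rw [lt_div_iff₀ (by positivity)]; linarith
  have : 1 / ((P.M (n + 1) : ℕ) : ℝ) ^ A.k < 1 / ((P.M (n + 1) : ℕ) : ℝ) ^ A.k :=
    calc 1 / ((P.M (n + 1) : ℕ) : ℝ) ^ A.k ≤ 1 / ((P.M n + idx : ℕ) : ℝ) ^ A.k := h1
      _ ≤ invertProb P.g A.B (P.M n + idx) := hGOOD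
      _ ≤ (P.T n : ℝ) / P.θinv A n + s ^ P.T n := hle
      _ ≤ 1 / (2 * ((P.M (n + 1) : ℕ) : ℝ) ^ A.k) + Real.exp (-(n : ℝ) / 2) := by rw [hT]; linarith
      _ < 1 / (2 * ((P.M (n + 1) : ℕ) : ℝ) ^ A.k) + 1 / (2 * ((P.M (n + 1) : ℕ) : ℝ) ^ A.k) := by linarith
      _ = 1 / ((P.M (n + 1) : ℕ) : ℝ) ^ A.k := by ring
  exact lt_irrefl _ this

/-- `θinv ≥ 1` for `n ≥ 1`. [folklore] -/
theorem one_le_θinv (hq : P.QPos) (hn : 0 < n) : 1 ≤ P.θinv A n := by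
  unfold θinv
  have h1 := T_pos hq hn
  have h2 : 0 < P.M (n + 1) := lt_of_lt_of_le (Nat.succ_pos n) (le_M hq (n + 1))
  have : 0 < 2 * P.T n * P.M (n + 1) ^ A.k := by positivity
  omega

/-- **The contradiction with weak one-wayness, at one block length**: for a good, large `n`
and a coin budget carrying the advice on all `⟨1ⁿ, f x⟩`, `|x| = n`,
`Pr[A' inverts f on U_n] > 1 - 1/q(n)`. [Goldreich 2001, §2.3.1 (end of the proof)]
[cite: Goldreich2001, Thm. 2.3.2 (proof)] -/
theorem invertProb_f_gt (hq : P.QPos) (hp : P.LenBound) (hκ' : κ < P.Kb A n) (hidx : P.M n + idx < P.M (n + 1)) (hn : 0 < n)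
    (hκ : A.B.coinLen (P.QL n idx) = κ)
    (hGOOD : 1 / ((P.M n + idx : ℕ) : ℝ) ^ A.k ≤ invertProb P.g A.B (P.M n + idx))
    (hE1 : 2 * ((P.M (n + 1) : ℕ) : ℝ) ^ A.k * Real.exp (-(n : ℝ) / 2) < 1)
    (hE2 : 2 * ((P.q.eval n : ℕ) : ℝ) * Real.exp (-(n : ℝ)) < 1) {cl : ℕ → ℕ}
    (hcl : ∀ x : List.Vector Bool n, cl (boolPair (unaryEncodeNat n) (P.f x.toList)).length = idx * P.Kb A n + κ + P.Base A n * P.R A n) :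
    1 - 1 / ((P.q.eval n : ℕ) : ℝ) < invertProb P.f (P.inv A cl) n := by
  have hS := density_good_ge hq hp hidx hn hκ hGOOD hE1
  have hge := invertProb_f_ge hκ' hidx hn hq hcl
  set s := ((univ.filter fun x : List.Vector Bool n => P.Good A n (P.M n + idx) (P.M n + idx + κ) x.toList).card : ℝ) / 2 ^ n
  set ρ : ℝ := (1 - 1 / (P.θinv A n : ℝ)) ^ P.reps A n
  have hρ : ρ ≤ Real.exp (-(n : ℝ)) := one_sub_div_pow_mul_le (one_le_θinv hq hn)
  have hq1 : (1 : ℝ) ≤ P.q.eval n := by exact_mod_cast hq n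
  have hq0 : (0 : ℝ) < P.q.eval n := by linarith
  have ha : 0 ≤ 1 - 1 / (2 * ((P.q.eval n : ℕ) : ℝ)) := by
    rw [sub_nonneg, div_le_one (by linarith)]; linarith
  have hb : 0 ≤ 1 - Real.exp (-(n : ℝ)) := by
    rw [sub_nonneg]; exact Real.exp_le_one_iff.2 (by simp)
  have he : Real.exp (-(n : ℝ)) < 1 / (2 * ((P.q.eval n : ℕ) : ℝ)) := by
    rw [lt_div_iff₀ (by positivity)]; linarith
  have hhalf : 1 / ((P.q.eval n : ℕ) : ℝ) = 1 / (2 * ((P.q.eval n : ℕ) : ℝ)) + 1 / (2 * ((P.q.eval n : ℕ) : ℝ)) := by field_simp; ring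
  calc 1 - 1 / ((P.q.eval n : ℕ) : ℝ) < (1 - 1 / (2 * ((P.q.eval n : ℕ) : ℝ))) * (1 - Real.exp (-(n : ℝ))) := by
        rw [hhalf]
        nlinarith [mul_nonneg ha (Real.exp_nonneg (-(n : ℝ))), he, Real.exp_nonneg (-(n : ℝ))]
    _ ≤ s * (1 - ρ) := mul_le_mul hS (by linarith) hb (ha.trans hS)
    _ ≤ invertProb P.f (P.inv A cl) n := hge

end Params

end Analysis

/-! ### Choosing the lengths to attack (the advice carried by the coin budget) -/

section Selection

/-- Some `b ≥ a` with `G b` (if any). [folklore] -/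
noncomputable def pick (G : ℕ → Prop) (a : ℕ) : ℕ :=
  open scoped Classical in if h : ∃ b, a ≤ b ∧ G b then Classical.choose h else a

/-- Specification of `pick`. [folklore] -/
theorem pick_spec {G : ℕ → Prop} {a : ℕ} (h : ∃ b, a ≤ b ∧ G b) : a ≤ pick G a ∧ G (pick G a) := by
  unfold pick; rw [dif_pos h]; exact Classical.choose_spec h

/-- A sparse increasing sequence of good lengths: consecutive terms are separated by the spread
`w` (so that the input-length ranges `[2n+2, w n]` of `⟨1ⁿ, f x⟩`, `|x| = n`, are disjoint and the
block length can be read off the input length). [folklore] -/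
noncomputable def seqN (G : ℕ → Prop) (w : ℕ → ℕ) : ℕ → ℕ
  | 0 => pick G 0
  | j + 1 => pick G (w (seqN G w j) + 1)

variable {G : ℕ → Prop} {w : ℕ → ℕ}

/-- All selected lengths are good. [folklore] -/
theorem seqN_good (hG : ∀ a, ∃ b, a ≤ b ∧ G b) : ∀ j, G (seqN G w j)
  | 0 => (pick_spec (hG 0)).2
  | _ + 1 => (pick_spec (hG _)).2

/-- Consecutive selected lengths are separated by the spread. [folklore] -/
theorem w_seqN_lt (hG : ∀ a, ∃ b, a ≤ b ∧ G b) (j : ℕ) : w (seqN G w j) < seqN G w (j + 1) :=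
  (pick_spec (hG (w (seqN G w j) + 1))).1

/-- The selected lengths increase. [folklore] -/
theorem seqN_strictMono (hG : ∀ a, ∃ b, a ≤ b ∧ G b) (hw : ∀ n, n ≤ w n) : StrictMono (seqN G w) :=
  strictMono_nat_of_lt_succ fun j => (hw _).trans_lt (w_seqN_lt hG j)

/-- The index of the selected length whose range contains `ℓ`. [folklore] -/
noncomputable def jOf (G : ℕ → Prop) (w : ℕ → ℕ) (ℓ : ℕ) : ℕ := sInf {j | ℓ ≤ w (seqN G w j)}

/-- The selected block length for the input length `ℓ`. [folklore] -/
noncomputable def sel (G : ℕ → Prop) (w : ℕ → ℕ) (ℓ : ℕ) : ℕ := seqN G w (jOf G w ℓ)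

/-- An input length in the range of the `j`-th selected length selects `j`. [folklore] -/
theorem jOf_eq (hG : ∀ a, ∃ b, a ≤ b ∧ G b) (hw : ∀ n, n ≤ w n) {j ℓ : ℕ} (h1 : seqN G w j ≤ ℓ) (h2 : ℓ ≤ w (seqN G w j)) :
    jOf G w ℓ = j := by
  have hmem : j ∈ {j | ℓ ≤ w (seqN G w j)} := h2
  apply le_antisymm (Nat.sInf_le hmem)
  by_contra hlt
  push Not at hlt
  have hm : jOf G w ℓ ∈ {j | ℓ ≤ w (seqN G w j)} := Nat.sInf_mem ⟨j, hmem⟩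
  have h3 : ℓ ≤ w (seqN G w (jOf G w ℓ)) := hm
  have h4 : w (seqN G w (jOf G w ℓ)) < seqN G w (jOf G w ℓ + 1) := w_seqN_lt hG _
  have h5 : seqN G w (jOf G w ℓ + 1) ≤ seqN G w j := (seqN_strictMono hG hw).monotone (Nat.succ_le_of_lt hlt)
  omega

/-- An input length in the range of a selected length selects it. [folklore] -/
theorem sel_eq (hG : ∀ a, ∃ b, a ≤ b ∧ G b) (hw : ∀ n, n ≤ w n) {j ℓ : ℕ} (h1 : seqN G w j ≤ ℓ) (h2 : ℓ ≤ w (seqN G w j)) :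
    sel G w ℓ = seqN G w j := by rw [sel, jOf_eq hG hw h1 h2]

end Selection

/-! ### The main theorem -/

section Main

open scoped Classical
open Polynomial

namespace Params

variable (P : Params) (A : Adv)

/-- `B'` does well at some target length `M n + idx` of block length `n`. [Goldreich 2001, §2.3.1 (the set `N'`)] [folklore] -/
def GoodLen (n : ℕ) : Prop :=
  ∃ idx, P.M n + idx < P.M (n + 1) ∧ 1 / ((P.M n + idx : ℕ) : ℝ) ^ A.k ≤ invertProb P.g A.B (P.M n + idx)

/-- The advice `idx(n)`: a good target length of block length `n` (else `0`). [folklore] -/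
noncomputable def idxA (n : ℕ) : ℕ := if h : P.GoodLen A n then Classical.choose h else 0

/-- The advice `κ(n)`: `B'`'s coin count on the queries at block length `n`. [folklore] -/
noncomputable def κA (n : ℕ) : ℕ := A.B.coinLen (P.QL n (P.idxA A n))

/-- The coin budget encoding the advice: `idx · K_b + κ + Base · R`. [folklore] -/
noncomputable def Code (n : ℕ) : ℕ := P.idxA A n * P.Kb A n + P.κA A n + P.Base A n * P.R A n

/-- A polynomial bound on `Code`. [folklore] -/
noncomputable def CodePoly : Polynomial ℕ := P.M1poly * P.Kpoly A + P.Kpoly A + P.Bpoly A * P.Rpoly A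

/-- The spread of input lengths of `⟨1ⁿ, f x⟩`, `|x| = n`: `2n + 2 + p(n)`. [folklore] -/
def spread (n : ℕ) : ℕ := 2 * n + 2 + P.p.eval n

/-- **The coin budget of `A'`**: on input length `ℓ` in the range of a selected block length `n`,
`Code n` coins. [folklore] -/
noncomputable def cl (G : ℕ → Prop) (ℓ : ℕ) : ℕ :=
  if 2 * sel G P.spread ℓ + 2 ≤ ℓ then P.Code A (sel G P.spread ℓ) else 0

variable {P A}

/-- The advised target length has block length `n`. [folklore] -/
theorem idxA_lt (n : ℕ) (hq : P.QPos) : P.M n + P.idxA A n < P.M (n + 1) := by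
  unfold idxA
  split_ifs with h
  · exact (Classical.choose_spec h).1
  · simpa using M_strictMono hq (Nat.lt_succ_self n)

/-- At a good block length the advised target length is one where `B'` does well. [folklore] -/
theorem idxA_spec {n : ℕ} (h : P.GoodLen A n) :
    1 / ((P.M n + P.idxA A n : ℕ) : ℝ) ^ A.k ≤ invertProb P.g A.B (P.M n + P.idxA A n) := by
  unfold idxA; rw [dif_pos h]; exact (Classical.choose_spec h).2

/-- The query length is monotone in `idx`. [folklore] -/
theorem QL_mono (n : ℕ) {a b : ℕ} (hab : a ≤ b) : P.QL n a ≤ P.QL n b := by unfold QL; omega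

/-- `κ(n) < K_b(n)`. [folklore] -/
theorem κA_lt (hq : P.QPos) (hqB : ∀ ℓ, A.B.coinLen ℓ ≤ A.qB.eval ℓ) (n : ℕ) : P.κA A n < P.Kb A n := by
  rw [Kb_eq, κA, Nat.lt_succ_iff]
  refine (hqB _).trans (natPoly_eval_mono _ (QL_mono n ?_))
  have := idxA_lt (A := A) n hq
  omega

/-- `Code n ≤ CodePoly(n)`. [folklore] -/
theorem Code_le (hq : P.QPos) (hqB : ∀ ℓ, A.B.coinLen ℓ ≤ A.qB.eval ℓ) (n : ℕ) : P.Code A n ≤ (P.CodePoly A).eval n := by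
  have h1 : P.idxA A n ≤ P.M (n + 1) := by have := idxA_lt (A := A) n hq; omega
  have h2 := (κA_lt hq hqB n).le
  simp only [Code, CodePoly, eval_add, eval_mul, eval_M1poly, eval_Rpoly, Kb, Base]
  have := Nat.mul_le_mul_right ((P.Kpoly A).eval n) h1
  unfold Kb at h2
  omega

/-- `n ≤ spread n`. [folklore] -/
theorem spread_ge (n : ℕ) : n ≤ P.spread n := by unfold spread; omega

/-- The coin budget is polynomially bounded. [folklore] -/
theorem cl_le (hq : P.QPos) (hqB : ∀ ℓ, A.B.coinLen ℓ ≤ A.qB.eval ℓ) (G : ℕ → Prop) (ℓ : ℕ) :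
    P.cl A G ℓ ≤ (P.CodePoly A).eval ℓ := by
  unfold cl
  split_ifs with h
  · exact (Code_le hq hqB _).trans (natPoly_eval_mono _ (by omega))
  · exact Nat.zero_le _

/-- **On the inputs `⟨1ⁿ, f x⟩`, `|x| = n`, of a selected block length `n` the budget is `Code n`.** [folklore] -/
theorem cl_eq {G : ℕ → Prop} (hG : ∀ a, ∃ b, a ≤ b ∧ G b) (hp : P.LenBound) (j : ℕ) {x : List Bool}
    (hx : x.length = seqN G P.spread j) :
    P.cl A G (boolPair (unaryEncodeNat (seqN G P.spread j)) (P.f x)).length = P.Code A (seqN G P.spread j) := by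
  have hℓ : (boolPair (unaryEncodeNat (seqN G P.spread j)) (P.f x)).length = 2 * seqN G P.spread j + 2 + (P.f x).length := by
    rw [length_boolPair, length_unaryEncodeNat]
  have hfx : (P.f x).length ≤ P.p.eval (seqN G P.spread j) := by rw [← hx]; exact hp x
  have hsel : sel G P.spread (boolPair (unaryEncodeNat (seqN G P.spread j)) (P.f x)).length = seqN G P.spread j :=
    sel_eq hG spread_ge (by rw [hℓ]; omega) (by rw [hℓ, spread]; omega)
  unfold cl
  rw [hsel, if_pos (by rw [hℓ]; omega)]

/-- **Yao's theorem, the core**: if `f` is weakly one-way with hardness polynomial `q` and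
output-length bound `p`, and the direct product `g` and the inverters `A'` are efficient, then
`g` is strongly one-way. [Yao 1982; Goldreich 2001, Thm. 2.3.2, §2.3.1] [cite: Goldreich2001, Thm. 2.3.2 (proof)] -/
theorem isOneWay_g (hq : P.QPos) (hp : P.LenBound)
    (hweak : ∀ B : RandAlg (List Bool) (List Bool), IsPPT B id →
      ∀ᶠ n in atTop, invertProb P.f B n ≤ 1 - 1 / ((P.q.eval n : ℕ) : ℝ))
    (hG : PolyTimeComputable id id P.g)
    (hI : ∀ (A : Adv) (cl : ℕ → ℕ), IsPPT A.B id → (∃ pc : Polynomial ℕ, ∀ ℓ, cl ℓ ≤ pc.eval ℓ) → IsPPT (P.inv A cl) id) :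
    IsOneWay P.g := by
  refine ⟨hG, fun B hB => ?_⟩
  by_contra hns
  obtain ⟨k, hfreq⟩ := exists_frequently_ge_of_not_superpolynomialDecay (fun m => invertProb_nonneg P.g B m) hns
  obtain ⟨qB, hqB⟩ := hB.2
  let A : Adv := ⟨B, k, qB⟩
  -- good block lengths are frequent
  have hgood : ∃ᶠ n in atTop, P.GoodLen A n := by
    have h1 : ∃ᶠ m in atTop, P.GoodLen A (P.nOf m) := by
      refine hfreq.mono fun m hm => ?_
      refine ⟨m - P.M (P.nOf m), ?_, ?_⟩
      · rw [Nat.add_sub_cancel' (M_nOf_le P m)]; exact lt_M_nOf_succ hq m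
      · rw [Nat.add_sub_cancel' (M_nOf_le P m)]; exact hm
    exact (tendsto_nOf hq).frequently h1
  -- the eventual size conditions
  have hE : ∀ᶠ n in atTop, 2 * ((P.M (n + 1) : ℕ) : ℝ) ^ A.k * Real.exp (-(n : ℝ) / 2) < 1 ∧
      2 * ((P.q.eval n : ℕ) : ℝ) * Real.exp (-(n : ℝ)) < 1 ∧ 0 < n := by
    have h1 := eventually_natPoly_mul_exp_lt (C 2 * P.M1poly ^ A.k) (c := 1 / 2) (by norm_num)
    have h2 := eventually_natPoly_mul_exp_lt (C 2 * P.q) (c := 1) one_pos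
    filter_upwards [h1, h2, eventually_gt_atTop 0] with n hn1 hn2 hn0
    refine ⟨?_, ?_, hn0⟩
    · have : ((eval n (C 2 * P.M1poly ^ A.k) : ℕ) : ℝ) = 2 * ((P.M (n + 1) : ℕ) : ℝ) ^ A.k := by
        simp [eval_M1poly]
      rw [this] at hn1
      convert hn1 using 3; ring
    · have : ((eval n (C 2 * P.q) : ℕ) : ℝ) = 2 * ((P.q.eval n : ℕ) : ℝ) := by simp
      rw [this] at hn2
      convert hn2 using 3; ring
  set G : ℕ → Prop := fun n => P.GoodLen A n ∧ (2 * ((P.M (n + 1) : ℕ) : ℝ) ^ A.k * Real.exp (-(n : ℝ) / 2) < 1 ∧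
      2 * ((P.q.eval n : ℕ) : ℝ) * Real.exp (-(n : ℝ)) < 1 ∧ 0 < n) with hGdef
  have hGfreq : ∃ᶠ n in atTop, G n := hgood.and_eventually hE
  have hG' : ∀ a, ∃ b, a ≤ b ∧ G b := fun a => by
    obtain ⟨b, hb, hGb⟩ := frequently_atTop.1 hGfreq a
    exact ⟨b, hb, hGb⟩
  -- the inverter with the advice-carrying coin budget
  have hPPT : IsPPT (P.inv A (P.cl A G)) id := hI A _ hB ⟨P.CodePoly A, cl_le (A := A) hq hqB G⟩
  have hev := hweak _ hPPT
  obtain ⟨N, hN⟩ := eventually_atTop.1 hev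
  set n := seqN G P.spread N with hn
  have hNn : N ≤ n := (seqN_strictMono hG' spread_ge).id_le N
  obtain ⟨hgoodn, hE1, hE2, hn0⟩ := seqN_good hG' N
  have hidx := idxA_lt (A := A) n hq
  have hκ' := κA_lt (A := A) hq hqB n
  have hgt := invertProb_f_gt (A := A) (idx := P.idxA A n) (κ := P.κA A n) hq hp hκ' hidx hn0 rfl (idxA_spec hgoodn) hE1 hE2
    (cl := P.cl A G) (fun x => cl_eq (A := A) hG' hp N x.toList_length)
  exact absurd (hN n hNn) (not_le.2 hgt)

end Params

/-- The output length of a polynomial-time function is polynomially bounded (private twin of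
`Literature.Computability.Complexity.exists_poly_length_le_of_mem_FP`, `CountingHierarchyProofs.lean`, not imported here).
[Arora–Barak 2009, §1.3] [folklore] -/
private theorem exists_lenBound {f : List Bool → List Bool} (hf : PolyTimeComputable id id f) :
    ∃ p : Polynomial ℕ, ∀ x, (f x).length ≤ p.eval x.length := by
  obtain ⟨p, M, hM⟩ := hf
  refine ⟨X + C (TM2Comp.machinePushBound M.tm) * p, fun x => ?_⟩
  have h := (hM x).length_le
  simpa using h

end Main

end Yao

/-! ### The efficiency facts and S05 -/

open Yao

/-- **Efficiency of Yao's direct product** (named fact, D-0014): for polynomial-time `f` and any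
polynomials `q, p`, the function `g` of `Yao.Params.g` — compute `n = nOf |w|`, split `w` into
`t(n)` blocks, apply `f` and pad each image to length `p(n)+1`, pair-encode with the suffix — is
polynomial-time computable. Print: "Clearly, `g` can be computed in polynomial time (by an
algorithm that breaks the input into blocks and applies `f` to each block)". To be discharged with
the `FP` toolkit (`IterateFP.lean`, `StackUnary.lean`). [Goldreich 2001, §2.3.1]
[cite: Goldreich2001, Thm. 2.3.2 (proof)] -/
def yaoFun_polyTime : Prop :=
  ∀ P : Yao.Params, PolyTimeComputable id id P.f → PolyTimeComputable id id P.g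

/-- **Efficiency of the inverter `A'`** (named fact, D-0014): for polynomial-time `f` and a PPT
`B'`, the run function `Yao.Params.run` of `A'` — decode `(idx, κ)` from the number of coins, then
`R(n)` trials each consisting of one evaluation of `g`, a string surgery, one run of `B'`, a block
extraction and one evaluation of `f` — is polynomial-time on the pair presentation of (input,
coins) (the time core of `IsPPT`; the coin budget is a separate, arbitrary polynomially bounded
function, `isPPT_inv_of`). Print: "we now present a probabilistic polynomial-time algorithm `A'`
for inverting `f`". To be discharged with the `FP` toolkit. [Goldreich 2001, §2.3.1]
[cite: Goldreich2001, Thm. 2.3.2 (proof)] -/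
def yaoRun_polyTime : Prop :=
  ∀ (P : Yao.Params) (A : Yao.Adv), PolyTimeComputable id id P.f → IsPPT A.B id →
    PolyTimeComputable (fun p : List Bool × List Bool => boolPair p.1 p.2) id (Function.uncurry (P.run A))

/-- From the run-core fact: `A'` with any polynomially bounded coin budget is PPT. [folklore] -/
theorem isPPT_inv_of (h : yaoRun_polyTime) (P : Yao.Params) (A : Yao.Adv) (cl : ℕ → ℕ)
    (hf : PolyTimeComputable id id P.f) (hB : IsPPT A.B id) (hcl : ∃ pc : Polynomial ℕ, ∀ ℓ, cl ℓ ≤ pc.eval ℓ) :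
    IsPPT (P.inv A cl) id :=
  ⟨h P A hf hB, hcl⟩

/-- **Yao's amplification** from the two efficiency facts: weak one-way functions give strong
one-way functions. [Yao 1982; Goldreich 2001, Thm. 2.3.2] [cite: Goldreich2001, Thm. 2.3.2] -/
theorem OWFExist_of_weakOWFExist_of (h₁ : yaoFun_polyTime) (h₂ : yaoRun_polyTime) : WeakOWFExist → OWFExist := by
  rintro ⟨f, hf, q, hq, hweak⟩
  obtain ⟨p, hp⟩ := exists_lenBound hf
  let P : Yao.Params := ⟨f, q, p⟩
  exact ⟨P.g, Params.isOneWay_g (P := P) hq hp hweak (h₁ P hf) fun A cl hB hcl => isPPT_inv_of h₂ P A cl hf hB hcl⟩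

/-- **S05 from the two efficiency facts**: `WeakOWFExist ↔ OWFExist` (`←` is
`IsOneWay.isWeaklyOneWay`). [Yao 1982; Goldreich 2001, Thm. 2.3.2] [cite: Goldreich2001, Thm. 2.3.2] -/
theorem weakOWFExist_iff_OWFExist_of (h₁ : yaoFun_polyTime) (h₂ : yaoRun_polyTime) : weakOWFExist_iff_OWFExist :=
  ⟨OWFExist_of_weakOWFExist_of h₁ h₂, fun ⟨f, hf⟩ => ⟨f, hf.isWeaklyOneWay⟩⟩

end Literature.Computability.Cryptography
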